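import Mathlib
import HarnessLib
import HarnessLib.Audit
import Summits.AnomalousDissipation.Statement
import Literature.Analysis.FluidPDE.LerayHopf
import Literature.Analysis.FluidPDE.ZerothLaw
import Literature.Analysis.FluidPDE.DoeringFoias
import Literature.Analysis.FluidPDE.StokesTorus
import Literature.Analysis.FluidPDE.StokesTorusProofs
import Literature.Analysis.FluidPDE.StatisticalSolution

/-!
Route: CoherentFraction

# Route CoherentFraction — bounded non-planar exact coherent states exist at small viscosity and
keep a three-dimensional fraction; bounded quiet planarity makes them loud

Decomposition node of cell decomp-ad (lens «minimal counterexample / extremal reduction», generation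
14), child of routes SymmetricOrLoud ▸ ClassTrim at the
pinned second-shell Kolmogorov force f_K = sin(4πx₁)e₀ on T³. The residual side of that lineage
(three-dimensional-fraction-or-loud trajectories, item
ThreeDFractionOrLoud) is attacked in its NORMAL FORM: exact coherent states (steady states and
time-periodic orbits), which realise their own long-time means,
so the recorded capture obstruction (a trajectory visiting three-dimensional states with vanishing
mean three-dimensional fraction) cannot occur. It suffices
to show X = X1 ∧ X2 ∧ X3 ∧ X4: X3 (BoundedNonPlanarCoherentStates, fixed-viscosity existence): along
some ν_j → 0 there are global Leray–Hopf solutions of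
NS_ν_j(f_K) that are time-periodic, have mean energy ≤ E₀ and POSITIVE mean planar-symmetry defect;
X4 (CoherentFractionPersists, declared residual): if so,
some such family keeps defect ≥ φ₀ · energy uniformly in j; X2 (BoundedQuietPlanarity, the lineage's
bounded rigidity door, item of ClassTrim): bounded quiet
Leray–Hopf solutions are relatively planar; X1 (RatioUpgrade): the rate-per-energy zeroth law
implies the audited one.
Lean: `RatioUpgrade ∧ BoundedQuietPlanarity ∧ BoundedNonPlanarCoherentStates ∧
CoherentFractionPersists`

## Assembly
Pure logic (theorem closes in glue.lean, every binder consumed): CoherentFractionPersists applied to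
BoundedNonPlanarCoherentStates gives E₀, φ₀, ν_j and
time-periodic global Leray–Hopf states u_j with meanEnergy ≤ E₀, 0 < defect and φ₀·meanEnergy ≤
defect; BoundedQuietPlanarity at (φ₀/2, E₀) gives θ₀; if
u_j were quiet (meanDissipation ≤ θ₀·meanEnergy) its defect would be ≤ (φ₀/2)·meanEnergy, which with
φ₀·meanEnergy ≤ defect forces meanEnergy ≤ 0 and
defect ≤ 0, contradicting 0 < defect; hence θ₀·meanEnergy < meanDissipation for every j, and the
tree lemmas isSmooth_stokesMode / isDivFree_stokesMode /
hasZeroMean_stokesMode (k = (0,2,0) ≠ 0, k·e₀ = 0) give the hypothesis of RatioUpgrade, which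
concludes.

Rationale: WHY THIS LINE. Exact coherent states are the extremal witnesses for a mean-fraction statement: their
means are honest period averages, so positivity of the defect of ONE
state is already positivity of the mean, and existence at fixed viscosity is a nonlinear elliptic /
bifurcation problem with no inviscid limit inside it.
The mechanism for X3 is explicit: the planar drift states u_p = p e₁ + V_p(x₁)e₀ of NS_ν(f_K)
(bounded energy p² + 1/(32π²(p²+16π²ν²))) carry, by an exact
Squire reduction with cross-flow and the Meshalkin–Sinai count (doi:10.1016/0021-8928(61)90079-2), a
symmetry-protected neutral oblique mode that viscosity
destabilises below a ν-independent cross-flow threshold p** ≈ 0.18 (dissipation-induced instability,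
doi:10.1103/RevModPhys.79.519); parity of the unstable
count and Krasnosel'skii–Rabinowitz bifurcation (doi:10.1016/0022-1236(71)90030-9) in the
fixed-point space of the reflections κ, σ′, τ₁ give non-planar steady
states of energy ≈ 0.13 at every small ν (Iudovich did the planar analogue,
doi:10.1016/0021-8928(65)90025-5). Imported areas: equivariant bifurcation theory
(Haragus–Iooss, doi:10.1007/978-0-85729-112-7; Golubitsky–Stewart–Schaeffer II),
exact-coherent-structure phenomenology of shear turbulence (doi:10.1146/annurev-fluid-120710-101228,
doi:10.1103/PhysRevLett.98.204501, doi:10.1088/0169-5983/48/6/061425, doi:10.1017/jfm.2017.97). What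
prior routes do not do: CoherentStates / HopfSnake /
SteadyWeakLimit / SteadyMirrorGate posit LOUD coherent families; here the existence side carries no
loudness at all (only a relative three-dimensional
fraction), loudness is the output of the rigidity door X2, and the large-energy half of the parent's
dichotomy input (LargeEnergyPlanarity) is not needed.

RANKED CRUXES. #2 CoherentFractionPersists (crux) — (declared RESIDUAL) if bounded non-planar
time-periodic global Leray–Hopf states of NS_ν_j(f_K) exist along some ν_j → 0 (the text of
BoundedNonPlanarCoherentStates), then along some ν_j → 0 there are such states whose mean
planar-symmetry defect is at least φ₀ times their mean energy, φ₀ > 0 uniform in j: the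
three-dimensional fraction of some bounded exact coherent family does not vanish in the inviscid
limit. BOOKING (cell critic, CLEARED 2026-08-30T14:40:58Z): OR-BRANCH of ClassTrim's residual
RecurrentEjectionPersists — with BoundedNonPlanarCoherentStates it is an R°-strength OR-sibling
(entails ThreeDFractionOrLoud), residual-axis credit NONE; credit is on the attack axis
(BoundedNonPlanarCoherentStates) and the instrument axis. E6 LABEL: the cone entails a bounded LOUD
exact coherent Leray–Hopf family at the pinned f_K (CoherentThesis-in-class,
summit-strength-in-class); the intended standing-wave satellites are STEADY, so the steady-shelf
exposure applies in full (periodic witnesses only in the weaker form). FALLBACK typing recorded: U′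
:= BoundedNonPlanarCoherentStates → ThreeDFractionOrLoud (weaker, but re-imports the large-energy
door). INSTRUMENT T-DRIFT-SW2 (census-priced, not commissioned): continuation of the mixed-mode
steady branch read along ν = ν_c/4 … ν_c/64 as (E, D/E, DEF/E) — O1 amplitude O(1), D/E → 0, DEF/E ≥
φ ⇒ BoundedQuietPlanarity and QuietTrajectoriesRelativelyPlanar refuted in the price sense; O2
amplitude ∝ √ν ⇒ this witness class flattens, U undecided (T-ECS3D next); O3 amplitude O(1) with D/E
↛ 0 ⇒ coherent zeroth-law evidence at f_K. [deps: BoundedNonPlanarCoherentStates] [difficulty: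
open-problem] (why it might fail: every bounded coherent family may flatten as ν → 0 (lower-branch
exact coherent states become streamwise-independent, i.e. planar, as Re → ∞; near-onset mixed-mode
branches have defect ∝ amplitude² which may scale with ν).) [doi:10.1103/PhysRevLett.98.204501,
doi:10.1146/annurev-fluid-120710-101228, doi:10.1088/0169-5983/48/6/061425, doi:10.1017/jfm.2017.97]
#3 BoundedNonPlanarCoherentStates (crux) — there are E₀ > 0 and viscosities 0 < ν_j ≤ 1, ν_j → 0,
and for every j a period T > 0 and a global Leray–Hopf solution u of NS_ν_j(sin(4πx₁)e₀) from some
u₀ which is T-periodic in time, has meanEnergy ≤ E₀ and positive mean planar-symmetry defect (not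
invariant in mean under any horizontal lattice translation family) — intended witnesses: the
dissipation-induced mixed-mode steady branch off the drift family at cross-flow p_c(ν) → p** ≈ 0.18.
ATTACKABLE NOW, THEOREM-GRADE (L) (critic-agreed; caveats: (α) simple real transversal crossing in
Fix(κ,σ′,τ₁) at each small ν and exclusion of other critical admissible modes are certified
numerically only — computer-assisted interval Galerkin or ν-perturbation off the regular inviscid
cross-flow problem; (β) non-planarity needs the STANDING-WAVE isotropy (both obliques present) — a
pure oblique travelling wave is planar; (γ) Leray–Hopf typing via the tree's classical ⇒ Leray–Hopf
theorem). [difficulty: L] (why it might fail: the odd-crossing/parity argument needs the unstable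
count of the drift family in Fix(κ,σ′,τ₁) to pass from 0 (large p) to exactly 1 (p → 0⁺) through the
oblique (1,±1) block at EVERY small ν; a competing planar block crossing first, or an even crossing,
voids it.) [doi:10.1016/0021-8928(61)90079-2, doi:10.1016/0021-8928(65)90025-5,
doi:10.1016/0022-1236(71)90030-9, doi:10.1016/0022-1236(71)90015-2, doi:10.1007/978-0-85729-112-7,
doi:10.1103/RevModPhys.79.519]
#4 BoundedQuietPlanarity (crux) — (verbatim the ClassTrim item BoundedQuietPlanarity, the bounded
half of the lineage's dichotomy input) for every φ > 0 and every energy bound M there is θ₀ > 0 such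
that for 0 < ν ≤ 1 every global Leray–Hopf solution of NS_ν(sin(4πx₁)e₀) with meanEnergy ≤ M and
meanDissipation ≤ θ₀ · meanEnergy has mean planar-symmetry defect ≤ φ · meanEnergy. [difficulty:
open-problem] (why it might fail: a bounded QUIET yet non-planar family at small ν — e.g.
O(1)-amplitude saturated mixed-mode satellites of the drift states (smooth, hence meanDissipation =
O(ν)) — refutes it for φ below their defect fraction.) [AlexakisDoering2006,
doi:10.1017/jfm.2012.524, doi:10.1103/RevModPhys.79.519, doi:10.1103/PhysRevLett.98.204501]
#9 RatioUpgrade (support) — (verbatim the SymmetricOrLoud / ClassTrim item RatioUpgrade) the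
rate-per-energy form of the zeroth law at some smooth divergence-free mean-zero steady force implies
AnomalousDissipation (Doering–Foias bookkeeping: energy bound from meanDissipation ≤ ‖f‖₂
√meanEnergy, floor from the amplitude bound). [difficulty: M] [DoeringFoias2002,
CheskidovDoeringPetrov2006]

TWO-LAYER PLAN. BoundedNonPlanarCoherentStates ⇐ (DriftSpectralParity: for every small ν the drift
family's linearisation in Fix(κ,σ′,τ₁) has no unstable eigenvalue for
large p and exactly one, in the oblique (1,±1) block, as p → 0⁺ — Squire reduction with cross-flow +
Meshalkin–Sinai + energy stability) →
(OddCrossingBranch: an odd crossing in that block yields a continuum of steady solutions with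
positive defect and energy ≤ 1 — Krasnosel'skii–Rabinowitz +
defect expansion + classical ⇒ Leray–Hopf) → BoundedNonPlanarCoherentStates.
CoherentFractionPersists ⇐ (MixedModeAmplitude: along the mixed-mode branch the
defect fraction reaches some φ₀ at bounded energy for every small ν) → CoherentFractionPersists; or
via turbulence-embedded equilibria / periodic orbits.
Nothing here is filed now.

KILL CRITERIA. E6 (steady-shelf exposure, mandatory label): the cone entails a bounded loud exact
coherent family at f_K, and the standing-wave satellites are steady. Refutation of
BoundedQuietPlanarity (shared with ClassTrim) by a bounded quiet non-planar family at f_K — in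
particular by O(1)-amplitude mixed-mode satellites
of the drift states — closes the route (close --reason refuted:BoundedQuietPlanarity) and is banked
as a barrier («quiet three-dimensional coherent states at
a non-laminarising force»). Refutation of CoherentFractionPersists (every bounded coherent family of
NS_ν(f_K) flattens) closes this OR-branch and returns the
lineage to the trajectory-side residual of ClassTrim. A proof of ThreeDFractionOrLoud or of the
zeroth law elsewhere moots the route; a proof of
BoundedNonPlanarCoherentStates alone promotes CoherentFractionPersists to the single remaining crux
of this branch.

NOT DECOMPOSED YET. The typed mechanism statement BoundedThreeDCoherentStates (the conclusion of
CoherentFractionPersists, filed as an aside, never staffed) and its kernel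
arrows to the parent items (→ RelativelyThreeDTrajectories → ThreeDFractionOrLoud → EjectionPersists
/ RecurrentEjectionPersists) live in the cell node file
HOME/decomp-ad-lens-4/g14/CoherentFraction.lean; the steady (rather than periodic) strengthening of
BoundedNonPlanarCoherentStates, zero-momentum variants,
and the spectral lemmas of the two-layer plan are layer-2 children, later. Constants (E₀ = 1, p** ≈
0.18, energy ≈ 0.13 at onset) are not optimised.

CHEAPEST FALSIFIER. T-DRIFT-SW step 2 (records-only; kit not allowed for this seat):
weakly-nonlinear / Newton continuation of the mixed-mode steady branch from p_c(ν) in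
Fix(κ,σ′,τ₁) for ν = ν_c/4 … ν_c/64, reading (energy, dissipation, defect/energy). Saturated
amplitude O(1) in ν ⇒ bounded quiet non-planar states ⇒
BoundedQuietPlanarity (and the parent door QuietTrajectoriesRelativelyPlanar) REFUTED; amplitude ∝
√ν ⇒ near-onset branches flatten (no decision on
CoherentFractionPersists, BoundedQuietPlanarity survives). Step 1 (linear spectra) was run locally
this session: real dissipation-induced crossing of the
oblique pair at p₁₁(ν) = 0.162, 0.174, 0.178, 0.179 for ν = 4·10⁻³, 2·10⁻³, 10⁻³, 5·10⁻⁴, growth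
rates ∝ ν, higher admissible modes stable.

NUMBERS. Drift family: amplitude A(p,ν) = 1/(4π√(p²+16π²ν²)), meanEnergy = p² + A²/2 (≈ 0.13 at p ≈
0.18), meanDissipation = ν/(2(p²+16π²ν²)) (tree aside
DriftStatesAreLerayHopf). Meshalkin–Sinai: Kolmogorov modes with α̃ < k_f = 4π unstable at large
Reynolds number, α̃ ≥ k_f never; on the unit lattice only
(1,0) and (1,±1) qualify (α̃/k_f = 1/2, 1/√2). Local spectra (truncation |k| ≤ 20–24):
two-dimensional threshold p₁₀(ν) → ≈ 0.22, oblique p₁₁(ν) → ≈ 0.18,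
inviscid Krein thresholds ≈ 0.16 / 0.14; (2,0) decoupled with rate −16π²ν.

DEFINITION REQUESTS. None: all statements are over
Literature.Analysis.FluidPDE.Torus.IsGlobalLerayHopf, meanEnergy, meanDissipation, longTimeAvgSup,
toTorus, stokesMode and
Mathlib's Function.Periodic.

Novelty: Searches (2026-08-30): lit search --hybrid "Kolmogorov flow loss of stability secondary stationary
flow bifurcation Yudovich Meshalkin Sinai" (6 docs; Frisch 1995 pp. 221–231, Haragus–Iooss 2010 pp.
147–149, Temam 1976); lit search --hybrid "lower branch coherent states asymptotic scaling
streamwise rolls streaks" (ECS thesis paper:galaxy-pdf-5896816221368375060 p.122); lit search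
--hybrid "dissipation-induced instability negative energy mode Krein signature" (Drazin 2002 pp.
122–131); lit galaxy search "Meshalkin|Kolmogorov flow" --star all (23 rows, noise),
"dissipation-induced instabilit|lower branch coherent" --star all (15 rows: panama:510577122213931
Bloch, panama:490382185988193 Marsden–Ratiu), "Krasnosel'skii|crossing number|odd algebraic
multiplicity" --star pdf (6 rows, noise); ledger negatives --problem AnomalousDissipation (6
entries, none related).
Nearest prior art found: doi:10.1088/0169-5983/48/6/061425 (van Veen–Goto: periodic orbits of
three-dimensional Kolmogorov flow at moderate Re) and doi:10.1016/0021-8928(65)90025-5 (Iudovich: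
secondary steady flows of the planar Kolmogorov problem by Krasnosel'skii bifurcation); in the tree,
route CoherentStates (loud bounded coherent family) and the aside RelativelyThreeDTrajectories of
SymmetricOrLoud.
Delta: existence of bounded NON-PLANAR coherent states is obtained at every small viscosity from a
dissipation-induced oblique bifurcation of the explicit drift family (cross-flow as the parameter),
and their loudness  [refs: 10.1088/0169-5983/48/6/061425, 10.1016/0021-8928(65, paper:galaxy-pdf-5896816221368375060, doi:10.1088/0169-5983/48/6/061425, doi:10.1016/0021-8928]

Barriers (technique_class: equivariant-bifurcation, coherent-structures, stability): - technique_class: equivariant-bifurcation, coherent-structures, stability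
- Literature.Barriers.AnomalousDissipation.AlexakisDoering2006_energyDissipationBound: used, not
fought — it makes planar (x₂- or otherwise translation-invariant) bounded families quiet, which is
why the existence cruxes demand a POSITIVE defect; the witnesses are genuinely three-dimensional.
- Literature.Barriers.AnomalousDissipation.BardosTitiWiedemann2012_thm5: outside —
viscosity-selected shear flows are planar steady states with zero defect; they inhabit neither
existence crux and satisfy the rigidity door.
- Literature.Barriers.AnomalousDissipation.BrueDeLellis2023_noAnomaly_beforeEulerSingularity: it
does not bite (infinite-time means of exact coherent states at fixed ν, not a finite window before
an Euler singularity); the bet of CoherentFractionPersists is that some bounded coherent family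
stays three-dimensional, and BoundedQuietPlanarity then forbids it to be smooth uniformly in ν.
- Literature.Barriers.AnomalousDissipation.Cheskidov2023_thm13_not_forceRobustNoAnomaly: outside —
the force is pinned, steady and ν-independent.
- Literature.Barriers.AnomalousDissipation.BuckmasterVicol2019_thm13: outside — every witness is a
global Leray–Hopf solution (indeed classical and time-periodic); convex-integration solutions are
inadmissible.
- Literature.Barriers.AnomalousDissipation.Cheskidov2023_thm21_noDissipationAnomaly: outside — no
identification of dissipation with energy loss is used; RatioUpg

History (route lifecycle, newest last):
- 2026-08-31T01:07:17Z · rev 8: dropped TameEulerClimatesPlanar — repair of BROKEN 2026-08-31T00:58:48Z (crit ACTION STATUS l.1315): split child TameEulerClimatesPlanar (27427) refuted-SUBSTANTIVE in the kernel by CrossedShear (planner-decomp-ad-lens-4-g22-0)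
- 2026-08-31T01:07:18Z · REPAIRED (drop TameEulerClimatesPlanar) — back to draft: repair of BROKEN 2026-08-31T00:58:48Z (crit ACTION STATUS l.1315): split child TameEulerClimatesPlanar (27427) refuted-SUBSTANTIVE in the kernel by CrossedShear (planner-decomp-ad-lens-4-g22-0)
- 2026-09-03T21:33:01Z · BROKEN — ExtremeClimatesPlanarBeyondFiniteModes (stmt-AnomalousDissipation-27871, aside) refuted by Summit.AnomalousDissipation.AnomalousDissipation.Theorems.CrossedShearRoot.not_extremeClimatesPlanarBeyondFiniteModes (refuter-decomp-ad-crit-1-g20-0)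
- 2026-09-03T21:52:45Z · rev 9: dropped ExtremeClimatesPlanarBeyondFiniteModes — repair of BROKEN 2026-09-03T21:33:01Z (crit g20 «ERRATUM + RULING» STATUS l.2595; boundary l.1137 lifted for this one aside-drop only): aside ExtremeClimatesPla (operator:999:2938478)
- 2026-09-03T21:52:45Z · REPAIRED (drop ExtremeClimatesPlanarBeyondFiniteModes) — back to draft: repair of BROKEN 2026-09-03T21:33:01Z (crit g20 «ERRATUM + RULING» STATUS l.2595; boundary l.1137 lifted for this one aside-drop only): aside ExtremeClimatesPla (operator:999:2938478)
- 2026-09-04T05:42:53Z · BROKEN — InvariantExtremeClimatesPlanar (stmt-AnomalousDissipation-28074, support) refuted by Summit.AnomalousDissipation.AnomalousDissipation.Theorems.CrossedShearOrbit.CoherentFractionInvariantExtremeClimatesPlanar_refuted (refuter-decomp-ad-crit-1-g21-0)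
- 2026-09-04T05:45:44Z · rev 10: dropped InvariantExtremeClimatesPlanar — repair of BROKEN 2026-09-04T05:42:53Z (crit g21 FACT + RULING decomp-ad STATUS l.2620): support InvariantExtremeClimatesPlanar (stmt-AnomalousDissipation-28074, (operator:999:4113919)
- 2026-09-04T05:45:47Z · REPAIRED (drop InvariantExtremeClimatesPlanar) — back to draft: repair of BROKEN 2026-09-04T05:42:53Z (crit g21 FACT + RULING decomp-ad STATUS l.2620): support InvariantExtremeClimatesPlanar (stmt-AnomalousDissipation-28074, (operator:999:4113919)

sub-problem: AnomalousDissipation · status: draft · opened planner-decomp-ad-lens-4-g14-0 2026-08-30T14:45:24Z · rev 10 · ledger route-AnomalousDissipation-CoherentFraction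
GENERATED by the gate from the ledger (D-0016/17). Provers cite these decls: `theorem foo : Summit.AnomalousDissipation.AnomalousDissipation.Theses.CoherentFraction.<Decl> := …` in Summits/AnomalousDissipation/AnomalousDissipation/Theorems/<Name>.lean.
-/

namespace Summit.AnomalousDissipation.AnomalousDissipation.Theses.CoherentFraction

open scoped BigOperators Topology Manifold Classical MeasureTheory ProbabilityTheory Matrix InnerProductSpace ComplexConjugate ContinuousMap
open Filter Set Function TopologicalSpace MeasureTheory

attribute [summit_statement] _root_.AnomalousDissipation

open Literature.Turb

/-! Retired items kept as plain definitions (history; not obligations of this route): landed proofs / closed glue still name them. -/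

-- tombstone: stmt-AnomalousDissipation-27427 was DROPPED from this route but is still named by active items / landed proofs — kept as a plain def (no route_item tag), not an obligation of this route
/-- retired stmt-AnomalousDissipation-27427 (dropped, gen 1) — refuted by Summit.AnomalousDissipation.AnomalousDissipation.Theorems.CrossedShearRoot.not_tameEulerClimatesPlanar. -/
def TameEulerClimatesPlanar : Prop :=
  ∀ (m : EuclideanSpace ℝ (Fin 3)) (R : ℝ) (μ : MeasureTheory.Measure (Literature.Analysis.FunctionSpaces.Torus.energySpace (Fin 3))), MeasureTheory.IsProbabilityMeasure μ → (∀ᵐ (v : ↥(Literature.Analysis.FunctionSpaces.Torus.energySpace (Fin 3))) ∂μ, Literature.Analysis.FunctionSpaces.Torus.eGradNormSq ((v : MeasureTheory.Lp (EuclideanSpace ℝ (Fin 3)) 2 (MeasureTheory.volume : MeasureTheory.Measure (UnitAddTorus (Fin 3)))) : UnitAddTorus (Fin 3) → EuclideanSpace ℝ (Fin 3)) ≤ ENNReal.ofReal R) → (∀ Φ : Literature.Analysis.FluidPDE.Torus.CylindricalTest (Fin 3), ∫ v, ((∫ x, ⟪⇑(Literature.Analysis.FluidPDE.Torus.stokesMode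 (![0, 2, 0] : Fin 3 → ℤ) (EuclideanSpace.single (0 : Fin 3) (1 : ℝ)) false) x, Φ.grad v x⟫_ℝ) + (∫ x, ⟪((v : MeasureTheory.Lp (EuclideanSpace ℝ (Fin 3)) 2 (MeasureTheory.volume : MeasureTheory.Measure (UnitAddTorus (Fin 3)))) : UnitAddTorus (Fin 3) → EuclideanSpace ℝ (Fin 3)) x, Literature.Analysis.FunctionSpaces.Torus.fderiv (Φ.grad v) x m⟫_ℝ) + Literature.Analysis.FluidPDE.Torus.inertialPairing (v : MeasureTheory.Lp (EuclideanSpace ℝ (Fin 3)) 2 (MeasureTheory.volume : MeasureTheory.Measure (UnitAddTorus (Fin 3)))) (Φ.grad v)) ∂μ = 0) → ∀ᵐ (v : ↥(Literature.Analysis.FunctionSpaces.Torus.energySpace (Fin 3))) ∂μ, (⨅ p : {p : ℤ × ℤ // p ≠ 0}, (1 / 2 : ℝ) * ∫ s in (0 : ℝ)..1, ∫ x, ‖((v : MeasureTheory.Lp (EuclideanSpace ℝ (Fin 3)) 2 (MeasureTheory.volume : MeasureTheory.Measure (UnitAddTorus (Fin 3)))) : UnitAddTorus (Fin 3) → EuclideanSpace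 ℝ (Fin 3)) (x + Literature.Analysis.FluidPDE.toTorus (fun i => s * (![((p.1.1 : ℤ) : ℝ), 0, ((p.1.2 : ℤ) : ℝ)] : Fin 3 → ℝ) i)) - ((v : MeasureTheory.Lp (EuclideanSpace ℝ (Fin 3)) 2 (MeasureTheory.volume : MeasureTheory.Measure (UnitAddTorus (Fin 3)))) : UnitAddTorus (Fin 3) → EuclideanSpace ℝ (Fin 3)) x‖ ^ 2) = 0

-- tombstone: stmt-AnomalousDissipation-27871 was DROPPED from this route but is still named by active items / landed proofs — kept as a plain def (no route_item tag), not an obligation of this route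
/-- retired stmt-AnomalousDissipation-27871 (dropped, gen None) — refuted by Summit.AnomalousDissipation.AnomalousDissipation.Theorems.CrossedShearRoot.not_extremeClimatesPlanarBeyondFiniteModes. -/
def ExtremeClimatesPlanarBeyondFiniteModes : Prop :=
  ∀ (m : EuclideanSpace ℝ (Fin 3)) (R : ℝ) (μ : MeasureTheory.Measure (Literature.Analysis.FunctionSpaces.Torus.energySpace (Fin 3))), μ ∈ Set.extremePoints ENNReal {ρ : MeasureTheory.Measure (Literature.Analysis.FunctionSpaces.Torus.energySpace (Fin 3)) | MeasureTheory.IsProbabilityMeasure ρ ∧ (∀ᵐ (v : ↥(Literature.Analysis.FunctionSpaces.Torus.energySpace (Fin 3))) ∂ρ, Literature.Analysis.FunctionSpaces.Torus.eGradNormSq ((v : MeasureTheory.Lp (EuclideanSpace ℝ (Fin 3)) 2 (MeasureTheory.volume : MeasureTheory.Measure (UnitAddTorus (Fin 3)))) : UnitAddTorus (Fin 3) → EuclideanSpace ℝ (Fin 3)) ≤ ENNReal.ofReal R) ∧ (∀ Φ : Literature.Analysis.FluidPDE.Torus.CylindricalTest (Fin 3), ∫ v, ((∫ x, ⟪⇑(Literature.Analysis.FluidPDE.Torus.stokesMode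 (![0, 2, 0] : Fin 3 → ℤ) (EuclideanSpace.single (0 : Fin 3) (1 : ℝ)) false) x, Φ.grad v x⟫_ℝ) + (∫ x, ⟪((v : MeasureTheory.Lp (EuclideanSpace ℝ (Fin 3)) 2 (MeasureTheory.volume : MeasureTheory.Measure (UnitAddTorus (Fin 3)))) : UnitAddTorus (Fin 3) → EuclideanSpace ℝ (Fin 3)) x, Literature.Analysis.FunctionSpaces.Torus.fderiv (Φ.grad v) x m⟫_ℝ) + Literature.Analysis.FluidPDE.Torus.inertialPairing (v : MeasureTheory.Lp (EuclideanSpace ℝ (Fin 3)) 2 (MeasureTheory.volume : MeasureTheory.Measure (UnitAddTorus (Fin 3)))) (Φ.grad v)) ∂ρ = 0)} → (¬ ∃ (v : ↥(Literature.Analysis.FunctionSpaces.Torus.energySpace (Fin 3))), (∃ N : ℕ, ((v : MeasureTheory.Lp (EuclideanSpace ℝ (Fin 3)) 2 (MeasureTheory.volume : MeasureTheory.Measure (UnitAddTorus (Fin 3)))) : UnitAddTorus (Fin 3) → EuclideanSpace ℝ (Fin 3)) =ᵐ[MeasureTheory.volume] Literature.Analysis.FunctionSpaces.Torus.fourierTruncate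 N ((v : MeasureTheory.Lp (EuclideanSpace ℝ (Fin 3)) 2 (MeasureTheory.volume : MeasureTheory.Measure (UnitAddTorus (Fin 3)))) : UnitAddTorus (Fin 3) → EuclideanSpace ℝ (Fin 3))) ∧ μ = MeasureTheory.Measure.dirac v) → ∀ᵐ (v : ↥(Literature.Analysis.FunctionSpaces.Torus.energySpace (Fin 3))) ∂μ, (⨅ p : {p : ℤ × ℤ // p ≠ 0}, (1 / 2 : ℝ) * ∫ s in (0 : ℝ)..1, ∫ x, ‖((v : MeasureTheory.Lp (EuclideanSpace ℝ (Fin 3)) 2 (MeasureTheory.volume : MeasureTheory.Measure (UnitAddTorus (Fin 3)))) : UnitAddTorus (Fin 3) → EuclideanSpace ℝ (Fin 3)) (x + Literature.Analysis.FluidPDE.toTorus (fun i => s * (![((p.1.1 : ℤ) : ℝ), 0, ((p.1.2 : ℤ) : ℝ)] : Fin 3 → ℝ) i)) - ((v : MeasureTheory.Lp (EuclideanSpace ℝ (Fin 3)) 2 (MeasureTheory.volume : MeasureTheory.Measure (UnitAddTorus (Fin 3)))) : UnitAddTorus (Fin 3) → EuclideanSpace ℝ (Fin 3)) x‖ ^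 2) = 0

-- tombstone: stmt-AnomalousDissipation-28074 was DROPPED from this route but is still named by active items / landed proofs — kept as a plain def (no route_item tag), not an obligation of this route
/-- retired stmt-AnomalousDissipation-28074 (dropped, gen None) — refuted by Summit.AnomalousDissipation.AnomalousDissipation.Theorems.CrossedShearOrbit.CoherentFractionInvariantExtremeClimatesPlanar_refuted. -/
def InvariantExtremeClimatesPlanar : Prop :=
  ∀ (m : EuclideanSpace ℝ (Fin 3)) (R : ℝ) (μ : MeasureTheory.Measure (Literature.Analysis.FunctionSpaces.Torus.energySpace (Fin 3))), μ ∈ Set.extremePoints ENNReal {ρ : MeasureTheory.Measure (Literature.Analysis.FunctionSpaces.Torus.energySpace (Fin 3)) | MeasureTheory.IsProbabilityMeasure ρ ∧ (∀ᵐ (v : ↥(Literature.Analysis.FunctionSpaces.Torus.energySpace (Fin 3))) ∂ρ, Literature.Analysis.FunctionSpaces.Torus.eGradNormSq ((v : MeasureTheory.Lp (EuclideanSpace ℝ (Fin 3)) 2 (MeasureTheory.volume : MeasureTheory.Measure (UnitAddTorus (Fin 3)))) : UnitAddTorus (Fin 3) → EuclideanSpace ℝ (Fin 3)) ≤ ENNReal.ofReal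 R) ∧ (∀ h : EuclideanSpace ℝ (Fin 3), ⟪h, EuclideanSpace.single (1 : Fin 3) (1 : ℝ)⟫_ℝ = 0 → (∀ Φ : Literature.Analysis.FluidPDE.Torus.CylindricalTest (Fin 3), ∫ v, ((∫ x, ⟪⇑(Literature.Analysis.FluidPDE.Torus.stokesMode (![0, 2, 0] : Fin 3 → ℤ) (EuclideanSpace.single (0 : Fin 3) (1 : ℝ)) false) x, Φ.grad v x⟫_ℝ) + (∫ x, ⟪((v : MeasureTheory.Lp (EuclideanSpace ℝ (Fin 3)) 2 (MeasureTheory.volume : MeasureTheory.Measure (UnitAddTorus (Fin 3)))) : UnitAddTorus (Fin 3) → EuclideanSpace ℝ (Fin 3)) x, Literature.Analysis.FunctionSpaces.Torus.fderiv (Φ.grad v) x (m + h)⟫_ℝ) + Literature.Analysis.FluidPDE.Torus.inertialPairing (v : MeasureTheory.Lp (EuclideanSpace ℝ (Fin 3)) 2 (MeasureTheory.volume : MeasureTheory.Measure (UnitAddTorus (Fin 3)))) (Φ.grad v)) ∂ρ = 0))} → ¬ (∃ N : ℕ, ∀ᵐ (v : ↥(Literature.Analysis.FunctionSpaces.Torus.energySpace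 (Fin 3))) ∂μ, ((v : MeasureTheory.Lp (EuclideanSpace ℝ (Fin 3)) 2 (MeasureTheory.volume : MeasureTheory.Measure (UnitAddTorus (Fin 3)))) : UnitAddTorus (Fin 3) → EuclideanSpace ℝ (Fin 3)) =ᵐ[MeasureTheory.volume] Literature.Analysis.FunctionSpaces.Torus.fourierTruncate N ((v : MeasureTheory.Lp (EuclideanSpace ℝ (Fin 3)) 2 (MeasureTheory.volume : MeasureTheory.Measure (UnitAddTorus (Fin 3)))) : UnitAddTorus (Fin 3) → EuclideanSpace ℝ (Fin 3))) → ∀ᵐ (v : ↥(Literature.Analysis.FunctionSpaces.Torus.energySpace (Fin 3))) ∂μ, (⨅ p : {p : ℤ × ℤ // p ≠ 0}, (1 / 2 : ℝ) * ∫ s in (0 : ℝ)..1, ∫ x, ‖((v : MeasureTheory.Lp (EuclideanSpace ℝ (Fin 3)) 2 (MeasureTheory.volume : MeasureTheory.Measure (UnitAddTorus (Fin 3)))) : UnitAddTorus (Fin 3) → EuclideanSpace ℝ (Fin 3)) (x + Literature.Analysis.FluidPDE.toTorus (fun i => s * (![((p.1.1 : ℤ) : ℝ), 0, ((p.1.2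 : ℤ) : ℝ)] : Fin 3 → ℝ) i)) - ((v : MeasureTheory.Lp (EuclideanSpace ℝ (Fin 3)) 2 (MeasureTheory.volume : MeasureTheory.Measure (UnitAddTorus (Fin 3)))) : UnitAddTorus (Fin 3) → EuclideanSpace ℝ (Fin 3)) x‖ ^ 2) = 0

/-- item stmt-AnomalousDissipation-33797 · crux · rank 2 · open · by planner
why it might fail: every bounded coherent family may flatten as ν → 0 (lower-branch exact coherent states become streamwise-independent, i.e. planar, as Re → ∞; near-onset mixed-mode branches have defect ∝ amplitude² which may scale with ν).
sources: doi:10.1103/PhysRevLett.98.204501, doi:10.1146/annurev-fluid-120710-101228, doi:10.1088/0169-5983/48/6/061425, doi:10.1017/jfm.2017.97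
[crux] (declared RESIDUAL) if bounded non-planar time-periodic global Leray–Hopf states of
NS_ν_j(f_K) exist along some ν_j → 0 (the text of BoundedNonPlanarCoherentStates), then along some
ν_j → 0 there are such states whose mean planar-symmetry defect is at least φ₀ times their mean
energy, φ₀ > 0 uniform in j: the three-dimensional fraction of some bounded exact coherent family
does not vanish in the inviscid limit. BOOKING (cell critic, CLEARED 2026-08-30T14:40:58Z):
OR-BRANCH of ClassTrim's residual RecurrentEjectionPersists — with BoundedNonPlanarCoherentStates it
is an R°-strength OR-sibling (entails ThreeDFractionOrLoud), residual-axis credit NONE; credit is on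
the attack axis (BoundedNonPlanarCoherentStates) and the instrument axis. E6 LABEL: the cone entails
a bounded LOUD exact coherent Leray–Hopf family at the pinned f_K (CoherentThesis-in-class,
summit-strength-in-class); the intended standing-wave satellites are STEADY, so the steady-shelf
exposure applies in full (periodic witnesses only in the weaker form). FALLBACK typing recorded: U′
:= BoundedNonPlanarCoherentStates → ThreeDFractionOrLoud (weaker, but re-imports the large-energy
door). INSTRUMENT T-DRIFT-SW2 (cen -/
@[route_item "route-AnomalousDissipation-CoherentFraction"]
def CoherentFractionPersists : Prop :=
  (∃ E₀ : ℝ, 0 < E₀ ∧ ∃ (ν : ℕ → ℝ), (∀ j, 0 < ν j) ∧ (∀ j, ν j ≤ 1) ∧ Filter.Tendsto ν Filter.atTop (nhds 0) ∧ ∀ j, ∃ (T : ℝ) (u₀ : UnitAddTorus (Fin 3) → EuclideanSpace ℝ (Fin 3)) (u : ℝ → UnitAddTorus (Fin 3) → EuclideanSpace ℝ (Fin 3)), 0 < T ∧ Literature.Analysis.FluidPDE.Torus.IsGlobalLerayHopf (ν j) (fun _ => ⇑(Literature.Analysis.FluidPDE.Torus.stokesMode (![0, 2, 0] : Fin 3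 → ℤ) (EuclideanSpace.single (0 : Fin 3) (1 : ℝ)) false)) u₀ u ∧ Function.Periodic u T ∧ Literature.Analysis.FluidPDE.meanEnergy u ≤ E₀ ∧ 0 < Literature.Analysis.FluidPDE.longTimeAvgSup (fun t => ⨅ p : {p : ℤ × ℤ // p ≠ 0}, (1 / 2 : ℝ) * ∫ s in (0 : ℝ)..1, ∫ x, ‖u t (x + Literature.Analysis.FluidPDE.toTorus (fun i => s * (![((p.1.1 : ℤ) : ℝ), 0, ((p.1.2 : ℤ) : ℝ)] : Fin 3 → ℝ) i)) - u t x‖ ^ 2)) → (∃ (E₀ φ₀ : ℝ), 0 < E₀ ∧ 0 < φ₀ ∧ ∃ (ν : ℕ → ℝ), (∀ j, 0 < ν j) ∧ (∀ j, ν j ≤ 1) ∧ Filter.Tendsto ν Filter.atTop (nhds 0) ∧ ∀ j, ∃ (T : ℝ) (u₀ : UnitAddTorus (Fin 3) → EuclideanSpace ℝ (Fin 3)) (u : ℝ → UnitAddTorus (Fin 3) → EuclideanSpace ℝ (Fin 3)), 0 < T ∧ Literature.Analysis.FluidPDE.Torus.IsGlobalLerayHopf (ν j) (fun _ => ⇑(Literature.Analysis.FluidPDE.Torus.stokesMode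 (![0, 2, 0] : Fin 3 → ℤ) (EuclideanSpace.single (0 : Fin 3) (1 : ℝ)) false)) u₀ u ∧ Function.Periodic u T ∧ Literature.Analysis.FluidPDE.meanEnergy u ≤ E₀ ∧ 0 < Literature.Analysis.FluidPDE.longTimeAvgSup (fun t => ⨅ p : {p : ℤ × ℤ // p ≠ 0}, (1 / 2 : ℝ) * ∫ s in (0 : ℝ)..1, ∫ x, ‖u t (x + Literature.Analysis.FluidPDE.toTorus (fun i => s * (![((p.1.1 : ℤ) : ℝ), 0, ((p.1.2 : ℤ) : ℝ)] : Fin 3 → ℝ) i)) - u t x‖ ^ 2) ∧ φ₀ * Literature.Analysis.FluidPDE.meanEnergy u ≤ Literature.Analysis.FluidPDE.longTimeAvgSup (fun t => ⨅ p : {p : ℤ × ℤ // p ≠ 0}, (1 / 2 : ℝ) * ∫ s in (0 : ℝ)..1, ∫ x, ‖u t (x + Literature.Analysis.FluidPDE.toTorus (fun i => s * (![((p.1.1 : ℤ) : ℝ), 0, ((p.1.2 : ℤ) : ℝ)] : Fin 3 → ℝ) i)) - u t x‖ ^ 2))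

/-- item stmt-AnomalousDissipation-33798 · crux · rank 3 · open · by planner
why it might fail: the odd-crossing/parity argument needs the unstable count of the drift family in Fix(κ,σ′,τ₁) to pass from 0 (large p) to exactly 1 (p → 0⁺) through the oblique (1,±1) block at EVERY small ν; a competing planar block crossing first, or an even crossing, voids it.
sources: doi:10.1016/0021-8928(61)90079-2, doi:10.1016/0021-8928(65)90025-5, doi:10.1016/0022-1236(71)90030-9, doi:10.1016/0022-1236(71)90015-2, doi:10.1007/978-0-85729-112-7, doi:10.1103/RevModPhys.79.519
[crux] there are E₀ > 0 and viscosities 0 < ν_j ≤ 1, ν_j → 0, and for every j a period T > 0 and a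
global Leray–Hopf solution u of NS_ν_j(sin(4πx₁)e₀) from some u₀ which is T-periodic in time, has
meanEnergy ≤ E₀ and positive mean planar-symmetry defect (not invariant in mean under any horizontal
lattice translation family) — intended witnesses: the dissipation-induced mixed-mode steady branch
off the drift family at cross-flow p_c(ν) → p** ≈ 0.18. ATTACKABLE NOW, THEOREM-GRADE (L)
(critic-agreed; caveats: (α) simple real transversal crossing in Fix(κ,σ′,τ₁) at each small ν and
exclusion of other critical admissible modes are certified numerically only — computer-assisted
interval Galerkin or ν-perturbation off the regular inviscid cross-flow problem; (β) non-planarity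
needs the STANDING-WAVE isotropy (both obliques present) — a pure oblique travelling wave is planar;
(γ) Leray–Hopf typing via the tree's classical ⇒ Leray–Hopf theorem). [difficulty: L] -/
@[route_item "route-AnomalousDissipation-CoherentFraction"]
def BoundedNonPlanarCoherentStates : Prop :=
  ∃ E₀ : ℝ, 0 < E₀ ∧ ∃ (ν : ℕ → ℝ), (∀ j, 0 < ν j) ∧ (∀ j, ν j ≤ 1) ∧ Filter.Tendsto ν Filter.atTop (nhds 0) ∧ ∀ j, ∃ (T : ℝ) (u₀ : UnitAddTorus (Fin 3) → EuclideanSpace ℝ (Fin 3)) (u : ℝ → UnitAddTorus (Fin 3) → EuclideanSpace ℝ (Fin 3)), 0 < T ∧ Literature.Analysis.FluidPDE.Torus.IsGlobalLerayHopf (ν j) (fun _ => ⇑(Literature.Analysis.FluidPDE.Torus.stokesMode (![0, 2, 0] : Fin 3 → ℤ) (EuclideanSpace.single (0 : Fin 3) (1 : ℝ)) false)) u₀ u ∧ Function.Periodic u T ∧ Literature.Analysis.FluidPDE.meanEnergy u ≤ E₀ ∧ 0 < Literature.Analysis.FluidPDE.longTimeAvgSup (fun t => ⨅ p : {p : ℤ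 × ℤ // p ≠ 0}, (1 / 2 : ℝ) * ∫ s in (0 : ℝ)..1, ∫ x, ‖u t (x + Literature.Analysis.FluidPDE.toTorus (fun i => s * (![((p.1.1 : ℤ) : ℝ), 0, ((p.1.2 : ℤ) : ℝ)] : Fin 3 → ℝ) i)) - u t x‖ ^ 2)

/-- item stmt-AnomalousDissipation-33307 · crux · rank 4 · SPLIT (gen 1) into TameEulerClimatesPlanar, TameClimateReduction, RoughQuietPlanarity + glue PlanarLiouvilleGlue · direct attempts still welcome (low priority) · by planner
why it might fail: a bounded QUIET yet non-planar family at small ν — e.g. O(1)-amplitude saturated mixed-mode satellites of the drift states (smooth, hence meanDissipation = O(ν)) — refutes it for φ below their defect fraction.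
sources: AlexakisDoering2006, doi:10.1017/jfm.2012.524, doi:10.1103/RevModPhys.79.519, doi:10.1103/PhysRevLett.98.204501
retired/moot children: TameEulerClimatesPlanar [dropped: ∀ (m : EuclideanSpace ℝ (Fin 3)) (R : ℝ) (μ : MeasureTheory.Measure (Literature.]
[crux · rank 2 (inherits H_R's) · THE DICHOTOMY'S HARD CORE in bounded-energy currency (bounded
energy is a HYPOTHESIS of a ∀-piece — G5 benign direction) · KERNEL-WEAKER (H_R → BQP by
restriction, node theorem weakerBQP; strictly weaker — BQP true, H_R false — in W_KPB) · IDEA-NEEDED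
+ INSTRUMENTABLE(T-3D-SYM relative reading; T-QROOT(f_K): relatively-3-D nondegenerate roots of the
truncated forced Euler system B(v,v) = f̂_K + IFT continuation) · BARRIER-ADJACENT
(Literature/Barriers/AnomalousDissipation/QuietRootFloorBarrier: a nondegenerate relatively-3-D
forced-Euler root at f_K continued to quiet bounded steady states is exactly ¬BQP's engine; the
known roots at f_K form the DEGENERATE planar family V = (−cos 4πx₁/(4πp) + a(x₂), p, 0))] BOUNDED
QUIET PLANARITY: for every φ > 0 and every absolute energy level M there is θ₀ > 0 such that for all
ν ∈ (0,1] every global Leray–Hopf solution of NS_ν(sin(4πx₁)e₀) with meanEnergy ≤ M that is quiet in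
ratio (meanDissipation ≤ θ₀·meanEnergy) has mean relative symmetry defect ≤ φ·meanEnergy (defect =
mean L²-energy off the nearest oblique Fourier plane n·k₀ + m·k₂ = 0, the 29269 functional
verbatim). H_R ⟺ LargeEnergyPlanarity ∧ BoundedQ -/
@[route_item "route-AnomalousDissipation-CoherentFraction"]
def BoundedQuietPlanarity : Prop :=
  ∀ φ : ℝ, 0 < φ → ∀ M : ℝ, 0 < M → ∃ θ₀ : ℝ, 0 < θ₀ ∧ ∀ ν : ℝ, 0 < ν → ν ≤ 1 → ∀ (u₀ : UnitAddTorus (Fin 3) → EuclideanSpace ℝ (Fin 3)) (u : ℝ → UnitAddTorus (Fin 3) → EuclideanSpace ℝ (Fin 3)), Literature.Analysis.FluidPDE.Torus.IsGlobalLerayHopf ν (fun _ => ⇑(Literature.Analysis.FluidPDE.Torus.stokesMode (![0, 2, 0] : Fin 3 → ℤ) (EuclideanSpace.single (0 : Fin 3) (1 : ℝ)) false)) u₀ u → Literature.Analysis.FluidPDE.meanEnergy u ≤ M → Literature.Analysis.FluidPDE.meanDissipation ν u ≤ θ₀ * Literature.Analysis.FluidPDE.meanEnergy u → Literature.Analysis.FluidPDE.longTimeAvgSup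 (fun t => ⨅ p : {p : ℤ × ℤ // p ≠ 0}, (1 / 2 : ℝ) * ∫ s in (0 : ℝ)..1, ∫ x, ‖u t (x + Literature.Analysis.FluidPDE.toTorus (fun i => s * (![((p.1.1 : ℤ) : ℝ), 0, ((p.1.2 : ℤ) : ℝ)] : Fin 3 → ℝ) i)) - u t x‖ ^ 2) ≤ φ * Literature.Analysis.FluidPDE.meanEnergy u

-- parent: BoundedQuietPlanarity · child (gen 1)
/--     item stmt-AnomalousDissipation-27429 · crux · rank 403 · open
    parent: BoundedQuietPlanarity · by planner
    why it might fail: W_rough: a bounded non-planar family whose enstrophy diverges slower than 1/ν (e.g. mixed-mode states with √ν internal layers: ‖∇u‖² ~ ν^{-1/2}, D ~ √ν·E → 0, DEF/E ≥ φ₀) would be rough, quiet and 3-D at once.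
    sources: corpus:paper:doi-10-1063-1-869159 p.1,13, doi:10.1017/S0022112096001294, corpus:paper:arxiv-nlin_0308025 p.1,10, corpus:book:frisch1995-turbulence-legacy-n-kolmogorov p.225, Literature.Analysis.FluidPDE.DoeringFoias2002_dissipation_le_power_holds, run/shared/lean/pub/decomp-ad/decomp-ad-lens-4/g15/FoundNothing_g15.md (T-DRIFT-MM pilot, segs ≥ 3)
[crux · rank 6 · THE K41 FACE OF BQP (rough half of the exact tame/rough cut, kept verbatim) ·
KERNEL-WEAKER than BQP (node `weakerRQP`, any R; strictly weaker in world W_root-visc where a TAME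
non-planar quiet family kills BQP and leaves this piece intact) · UNDECIDED · IDEA-NEEDED (no
ν-uniform loudness mechanism for SUSTAINED roughness at bounded energy is known —
dissipative-anomaly side) + INSTRUMENTABLE (census T-DRIFT-MM v2: continue the g15 mixed-mode /
travelling-rectangle branches of NS_ν(f_K) to small ν tracking (sup‖∇u‖², D/E, DEF/E): a bounded
branch with ‖∇u‖² → ∞, D/E → 0, DEF/E ≥ φ₀ kills this piece and BQP; 3-D Kolmogorov-flow DNS
phenomenology says bounded rough states are loud)] ROUGH QUIET PLANARITY: for SOME enstrophy level
R, for every φ > 0 and energy level M there is θ₀ > 0 such that for all ν ∈ (0,1] every global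
Leray–Hopf solution of NS_ν(sin(4πx₁)e₀) whose enstrophy ‖∇u(t)‖₂² exceeds R at arbitrarily late
times (frequently in `atTop`, honest ℝ≥0∞ order), with meanEnergy ≤ M and meanDissipation ≤
θ₀·meanEnergy, has mean planar defect ≤ φ·meanEnergy (33307 functional verbatim). Informally:
sustained rough three-dimensional motion at bounded energy is loud; -/
@[route_item "route-AnomalousDissipation-CoherentFraction"]
def RoughQuietPlanarity : Prop :=
  ∃ R : ℝ, ∀ φ : ℝ, 0 < φ → ∀ M : ℝ, 0 < M → ∃ θ₀ : ℝ, 0 < θ₀ ∧ ∀ ν : ℝ, 0 < ν → ν ≤ 1 → ∀ (u₀ : UnitAddTorus (Fin 3) → EuclideanSpace ℝ (Fin 3)) (u : ℝ → UnitAddTorus (Fin 3) → EuclideanSpace ℝ (Fin 3)), Literature.Analysis.FluidPDE.Torus.IsGlobalLerayHopf ν (fun _ => ⇑(Literature.Analysis.FluidPDE.Torus.stokesMode (![0, 2, 0] : Fin 3 → ℤ) (EuclideanSpace.single (0 : Fin 3) (1 : ℝ)) false)) u₀ u → (∃ᶠ t in Filter.atTop, ENNReal.ofReal R < Literature.Analysis.FunctionSpaces.Torus.eGradNormSq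 (u t)) → Literature.Analysis.FluidPDE.meanEnergy u ≤ M → Literature.Analysis.FluidPDE.meanDissipation ν u ≤ θ₀ * Literature.Analysis.FluidPDE.meanEnergy u → Literature.Analysis.FluidPDE.longTimeAvgSup (fun t => ⨅ p : {p : ℤ × ℤ // p ≠ 0}, (1 / 2 : ℝ) * ∫ s in (0 : ℝ)..1, ∫ x, ‖u t (x + Literature.Analysis.FluidPDE.toTorus (fun i => s * (![((p.1.1 : ℤ) : ℝ), 0, ((p.1.2 : ℤ) : ℝ)] : Fin 3 → ℝ) i)) - u t x‖ ^ 2) ≤ φ * Literature.Analysis.FluidPDE.meanEnergy u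

-- parent: BoundedQuietPlanarity · child (gen 1)
/--     item stmt-AnomalousDissipation-27428 · support · rank 402 · open
    parent: BoundedQuietPlanarity · by planner
    why it might fail: Only the bookkeeping can fail: the drift/momentum variant of the FMRT time-average theory and the ν→0 limit of the cylindrical identity on the compact K_R must be typed against the tree's CylindricalTest class (C¹_b cylinder functions suffice).
    sources: corpus:book:foias2001-navier-stokes-equations-turbulence p.188-189, corpus:book:kuksin2012-mathematics-two-dimensional-turbulence p.207-235, Literature.Analysis.FluidPDE.exists_timeAverageMeasure_holds, Literature.Analysis.FluidPDE.timeAverage_isStationary_holds, arXiv:1302.0542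
[support · THEOREM-GRADE · ATTACKABLE NOW (crit 16:54:02Z: SMG 27200 precedent)] TAME-CLIMATE
REDUCTION: the Liouville statement implies BQP restricted, for every R, to trajectories that are
eventually R-tame (‖∇u(t)‖₂² ≤ R for all late t). Proof route (FMRT Ch. IV currency, all tools in
tree or routine): ¬(tame quiet planarity) yields R, φ, M and global Leray–Hopf trajectories u_n of
NS_ν_n(f_K), ν_n ∈ (0,1], eventually R-tame, meanEnergy ≤ M, meanDissipation ≤ meanEnergy/n, mean
defect > φ·meanEnergy; (a) ν_n ≥ ν_* > 0 infinitely often is impossible: Poincaré on mean-free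
Fourier modes gives meanDissipation ≥ 4π²ν_*·(mean defect) ≥ 4π²ν_*·φ·meanEnergy, and meanEnergy = 0
forces defect 0; (b) along ν_n → 0: the momentum m_n(t) = ∫u_n is conserved (constant
divergence-free test fields are admissible in `IsWeakNSSolutionForcedOn`, f_K and the nonlinearity
are mean-free), |m_n|² ≤ M; the lift U_n = u_n − m_n ∈ H is eventually in the norm-compact set K_R =
{eGradNormSq ≤ R} (Rellich); time-average measures μ_n of U_n w.r.t. a Banach generalized limit
chosen to realise the defect limsup exist and are stationary statistical solutions of NS_ν_n(f_K)
with drift m_n (drift variant of the t -/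
@[route_item "route-AnomalousDissipation-CoherentFraction"]
def TameClimateReduction : Prop :=
  (∀ (m : EuclideanSpace ℝ (Fin 3)) (R : ℝ) (μ : MeasureTheory.Measure (Literature.Analysis.FunctionSpaces.Torus.energySpace (Fin 3))), MeasureTheory.IsProbabilityMeasure μ → (∀ᵐ (v : ↥(Literature.Analysis.FunctionSpaces.Torus.energySpace (Fin 3))) ∂μ, Literature.Analysis.FunctionSpaces.Torus.eGradNormSq ((v : MeasureTheory.Lp (EuclideanSpace ℝ (Fin 3)) 2 (MeasureTheory.volume : MeasureTheory.Measure (UnitAddTorus (Fin 3)))) : UnitAddTorus (Fin 3) → EuclideanSpace ℝ (Fin 3)) ≤ ENNReal.ofReal R) → (∀ Φ : Literature.Analysis.FluidPDE.Torus.CylindricalTest (Fin 3), ∫ v, ((∫ x, ⟪⇑(Literature.Analysis.FluidPDE.Torus.stokesMode (![0, 2, 0] : Fin 3 → ℤ) (EuclideanSpace.single (0 : Fin 3) (1 : ℝ)) false) x, Φ.grad v x⟫_ℝ) + (∫ x, ⟪((v : MeasureTheory.Lp (EuclideanSpace ℝ (Fin 3)) 2 (MeasureTheory.volume : MeasureTheory.Measure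 (UnitAddTorus (Fin 3)))) : UnitAddTorus (Fin 3) → EuclideanSpace ℝ (Fin 3)) x, Literature.Analysis.FunctionSpaces.Torus.fderiv (Φ.grad v) x m⟫_ℝ) + Literature.Analysis.FluidPDE.Torus.inertialPairing (v : MeasureTheory.Lp (EuclideanSpace ℝ (Fin 3)) 2 (MeasureTheory.volume : MeasureTheory.Measure (UnitAddTorus (Fin 3)))) (Φ.grad v)) ∂μ = 0) → ∀ᵐ (v : ↥(Literature.Analysis.FunctionSpaces.Torus.energySpace (Fin 3))) ∂μ, (⨅ p : {p : ℤ × ℤ // p ≠ 0}, (1 / 2 : ℝ) * ∫ s in (0 : ℝ)..1, ∫ x, ‖((v : MeasureTheory.Lp (EuclideanSpace ℝ (Fin 3)) 2 (MeasureTheory.volume : MeasureTheory.Measure (UnitAddTorus (Fin 3)))) : UnitAddTorus (Fin 3) → EuclideanSpace ℝ (Fin 3)) (x + Literature.Analysis.FluidPDE.toTorus (fun i => s * (![((p.1.1 : ℤ) : ℝ), 0, ((p.1.2 : ℤ) : ℝ)] : Fin 3 → ℝ) i)) - ((v : MeasureTheory.Lp (EuclideanSpace ℝ (Fin 3)) 2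 (MeasureTheory.volume : MeasureTheory.Measure (UnitAddTorus (Fin 3)))) : UnitAddTorus (Fin 3) → EuclideanSpace ℝ (Fin 3)) x‖ ^ 2) = 0) → ∀ R : ℝ, ∀ φ : ℝ, 0 < φ → ∀ M : ℝ, 0 < M → ∃ θ₀ : ℝ, 0 < θ₀ ∧ ∀ ν : ℝ, 0 < ν → ν ≤ 1 → ∀ (u₀ : UnitAddTorus (Fin 3) → EuclideanSpace ℝ (Fin 3)) (u : ℝ → UnitAddTorus (Fin 3) → EuclideanSpace ℝ (Fin 3)), Literature.Analysis.FluidPDE.Torus.IsGlobalLerayHopf ν (fun _ => ⇑(Literature.Analysis.FluidPDE.Torus.stokesMode (![0, 2, 0] : Fin 3 → ℤ) (EuclideanSpace.single (0 : Fin 3) (1 : ℝ)) false)) u₀ u → (∀ᶠ t in Filter.atTop, Literature.Analysis.FunctionSpaces.Torus.eGradNormSq (u t) ≤ ENNReal.ofReal R) → Literature.Analysis.FluidPDE.meanEnergy u ≤ M → Literature.Analysis.FluidPDE.meanDissipation ν u ≤ θ₀ * Literature.Analysis.FluidPDE.meanEnergy u → Literature.Analysis.FluidPDE.longTimeAvgSup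 (fun t => ⨅ p : {p : ℤ × ℤ // p ≠ 0}, (1 / 2 : ℝ) * ∫ s in (0 : ℝ)..1, ∫ x, ‖u t (x + Literature.Analysis.FluidPDE.toTorus (fun i => s * (![((p.1.1 : ℤ) : ℝ), 0, ((p.1.2 : ℤ) : ℝ)] : Fin 3 → ℝ) i)) - u t x‖ ^ 2) ≤ φ * Literature.Analysis.FluidPDE.meanEnergy u

-- parent: BoundedQuietPlanarity · glue (gen 1)
/--     item stmt-AnomalousDissipation-27430 · support · rank 404 · closed · proved by Summit.AnomalousDissipation.AnomalousDissipation.Theorems.PlanarLiouvilleGlue.planarLiouvilleGlue_holds (prover)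
    parent: BoundedQuietPlanarity · GLUE: children ⟹ parent · by planner
TameEulerClimatesPlanar → TameClimateReduction → RoughQuietPlanarity → BoundedQuietPlanarity (exact
tame/rough cut of BQP along eventual pointwise enstrophy; θ₀ := min of the two halves; kernel
planarLiouvilleGlue_holds, tree-context port pkg/PasteCheck_g16.lean planarLiouvilleGlue_paste, uses
Literature.Analysis.FluidPDE.meanEnergy_nonneg) -/
@[route_item "route-AnomalousDissipation-CoherentFraction"]
def PlanarLiouvilleGlue : Prop :=
  TameEulerClimatesPlanar → TameClimateReduction → RoughQuietPlanarity → BoundedQuietPlanarity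

-- `PlanarLiouvilleGlue` holds: proved by `Summit.AnomalousDissipation.AnomalousDissipation.Theorems.PlanarLiouvilleGlue.planarLiouvilleGlue_holds` (its module imports this route file, so no `_holds` link can be stated here).

/-- item stmt-AnomalousDissipation-23805 · support · rank 9 · open · by planner
sources: DoeringFoias2002, CheskidovDoeringPetrov2006
[crux] the rate-per-energy form of the zeroth law (some smooth divergence-free mean-zero steady
force, some θ > 0, ν_j → 0, global Leray–Hopf solutions with θ·meanEnergy(u_j) <
meanDissipation(ν_j,u_j)) implies AnomalousDissipation: the energy bound comes from meanDissipation
≤ ‖f‖₂·√meanEnergy, the floor from the Doering–Foias amplitude bound (meanEnergy ≥ c(f) > 0 for ν ≤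
1, f ≠ 0 being forced by the strict ratio inequality). [difficulty: M] -/
@[route_item "route-AnomalousDissipation-CoherentFraction"]
def RatioUpgrade : Prop :=
  (∃ f : UnitAddTorus (Fin 3) → EuclideanSpace ℝ (Fin 3), Literature.Analysis.FunctionSpaces.Torus.IsSmooth f ∧ Literature.Analysis.FunctionSpaces.Torus.IsDivFree f ∧ Literature.Analysis.FunctionSpaces.Torus.HasZeroMean f ∧ ∃ θ : ℝ, 0 < θ ∧ ∃ (ν : ℕ → ℝ) (u₀ : ℕ → UnitAddTorus (Fin 3) → EuclideanSpace ℝ (Fin 3)) (u : ℕ → ℝ → UnitAddTorus (Fin 3) → EuclideanSpace ℝ (Fin 3)), (∀ j, 0 < ν j) ∧ Filter.Tendsto ν Filter.atTop (nhds 0) ∧ (∀ j, Literature.Analysis.FluidPDE.Torus.IsGlobalLerayHopf (ν j) (fun _ => f) (u₀ j) (u j)) ∧ ∀ j, θ * Literature.Analysis.FluidPDE.meanEnergy (u j) < Literature.Analysis.FluidPDE.meanDissipation (ν j) (u j)) → _root_.AnomalousDissipation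

/-- item stmt-AnomalousDissipation-27440 · aside · rank 9 · open · by planner
why it might fail: W_root-visc: a viscosity-selected non-planar steady/recurrent H¹ state of NS_ν(f_K) continuing to ν → 0 at bounded enstrophy (QuietRootFloor mechanism) is tame, quiet, bounded and 3-D.
sources: Literature/Barriers/AnomalousDissipation/QuietRootFloorBarrier.lean, corpus:book:foias2001-navier-stokes-equations-turbulence p.188-189
[aside · rank 9 · EXACTNESS WITNESS of the PlanarLiouvilleGate cut · never staffed] TAME QUIET
PLANARITY: BQP restricted, for every enstrophy level R, to global Leray–Hopf trajectories that are
eventually R-tame (‖∇u(t)‖₂² ≤ R for all late t). [decomp-ad lens-4 g16 node PlanarLiouvilleGate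
(run/shared/lean/pub/decomp-ad/decomp-ad-lens-4/g16/PlanarLiouvilleGate.lean rc0 · 0 sorry · 0 warn;
card PlanarLiouvilleGate_NODE.md; bc7 6/6 CLEAN; pkg/PasteCheck_g16.lean)] -/
@[route_item "route-AnomalousDissipation-CoherentFraction"]
def TameQuietPlanarity : Prop :=
  ∀ R : ℝ, ∀ φ : ℝ, 0 < φ → ∀ M : ℝ, 0 < M → ∃ θ₀ : ℝ, 0 < θ₀ ∧ ∀ ν : ℝ, 0 < ν → ν ≤ 1 → ∀ (u₀ : UnitAddTorus (Fin 3) → EuclideanSpace ℝ (Fin 3)) (u : ℝ → UnitAddTorus (Fin 3) → EuclideanSpace ℝ (Fin 3)), Literature.Analysis.FluidPDE.Torus.IsGlobalLerayHopf ν (fun _ => ⇑(Literature.Analysis.FluidPDE.Torus.stokesMode (![0, 2, 0] : Fin 3 → ℤ) (EuclideanSpace.single (0 : Fin 3) (1 : ℝ)) false)) u₀ u → (∀ᶠ t in Filter.atTop, Literature.Analysis.FunctionSpaces.Torus.eGradNormSq (u t) ≤ ENNReal.ofReal R) → Literature.Analysis.FluidPDE.meanEnergy u ≤ M → Literature.Analysis.FluidPDE.meanDissipation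 ν u ≤ θ₀ * Literature.Analysis.FluidPDE.meanEnergy u → Literature.Analysis.FluidPDE.longTimeAvgSup (fun t => ⨅ p : {p : ℤ × ℤ // p ≠ 0}, (1 / 2 : ℝ) * ∫ s in (0 : ℝ)..1, ∫ x, ‖u t (x + Literature.Analysis.FluidPDE.toTorus (fun i => s * (![((p.1.1 : ℤ) : ℝ), 0, ((p.1.2 : ℤ) : ℝ)] : Fin 3 → ℝ) i)) - u t x‖ ^ 2) ≤ φ * Literature.Analysis.FluidPDE.meanEnergy u

/-- item stmt-AnomalousDissipation-27870 · support · rank 9 · open · by planner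
why it might fail: A non-planar EXACT root supported on ≥ 2 resonant triads {±a,±b,±k_f}, a+b = c+d = k_f with non-parallel horizontal projections, all cross-pairs KY-non-interacting (the forced-pair loophole); decidable by finite algebra on supports |k|∞ ≤ 3 (instrument T-QROOT-ALG).
sources: arXiv:2110.08039 Thm 1.4, Lemma 2.1, Prop 2.2, §6 (Kishimoto–Yoneda, JMFM 24 (2022) 74, doi:10.1007/s00021-022-00703-5), Elgindi–Hu–Šverák, Comm. Math. Phys. 355 (2017) 145–159, Literature/Barriers/AnomalousDissipation/QuietRootFloorBarrier.lean (scope caveat (i))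
[support · rank 9 · BC5/T3 RUNG of TameEulerClimatesPlanar 27427 / BoundedQuietPlanarity 33307 ·
lens-4 g17 node SpectralHullCut] FINITE-MODE ROOTS ARE PLANAR: for every constant drift m, enstrophy
level R and every div-free mean-zero L² field v on T³ with finitely many Fourier modes (v =
fourierTruncate N v a.e.), ‖∇v‖² ≤ R, that is a steady weak root of Euler + (m·∇) + f_K (f_K =
sin(4πx₁)e₀) against every cylindrical test, the planarity defect inf_{p∈ℤ²∖0} ½∫₀¹‖v(·+s(p₁,0,p₂))
− v‖² ds vanishes. = TEP restricted to Dirac climates at finite-mode fields (kernel weakerF).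
Engine: Kishimoto–Yoneda finite-Fourier-support rigidity (convex hull of the support + two-mode
interaction lemma) adapted to the forced pair ±(0,2,0) and the diagonal drift term; skeleton
bc/FiniteModeRootsPlanar_birth.lean (stub_hullRigidity, stub_defectOfInvariant). Kernel
run/shared/lean/pub/decomp-ad/decomp-ad-lens-4/g17/SpectralHullCut.lean -/
@[route_item "route-AnomalousDissipation-CoherentFraction"]
def FiniteModeRootsPlanar : Prop :=
  ∀ (m : EuclideanSpace ℝ (Fin 3)) (R : ℝ) (v : ↥(Literature.Analysis.FunctionSpaces.Torus.energySpace (Fin 3))), (∃ N : ℕ, ((v : MeasureTheory.Lp (EuclideanSpace ℝ (Fin 3)) 2 (MeasureTheory.volume : MeasureTheory.Measure (UnitAddTorus (Fin 3)))) : UnitAddTorus (Fin 3) → EuclideanSpace ℝ (Fin 3)) =ᵐ[MeasureTheory.volume] Literature.Analysis.FunctionSpaces.Torus.fourierTruncate N ((v : MeasureTheory.Lp (EuclideanSpace ℝ (Fin 3)) 2 (MeasureTheory.volume : MeasureTheory.Measure (UnitAddTorus (Fin 3)))) : UnitAddTorus (Fin 3) → EuclideanSpace ℝ (Fin 3)))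 → Literature.Analysis.FunctionSpaces.Torus.eGradNormSq ((v : MeasureTheory.Lp (EuclideanSpace ℝ (Fin 3)) 2 (MeasureTheory.volume : MeasureTheory.Measure (UnitAddTorus (Fin 3)))) : UnitAddTorus (Fin 3) → EuclideanSpace ℝ (Fin 3)) ≤ ENNReal.ofReal R → (∀ Φ : Literature.Analysis.FluidPDE.Torus.CylindricalTest (Fin 3), ((∫ x, ⟪⇑(Literature.Analysis.FluidPDE.Torus.stokesMode (![0, 2, 0] : Fin 3 → ℤ) (EuclideanSpace.single (0 : Fin 3) (1 : ℝ)) false) x, Φ.grad v x⟫_ℝ) + (∫ x, ⟪((v : MeasureTheory.Lp (EuclideanSpace ℝ (Fin 3)) 2 (MeasureTheory.volume : MeasureTheory.Measure (UnitAddTorus (Fin 3)))) : UnitAddTorus (Fin 3) → EuclideanSpace ℝ (Fin 3)) x, Literature.Analysis.FunctionSpaces.Torus.fderiv (Φ.grad v) x m⟫_ℝ) + Literature.Analysis.FluidPDE.Torus.inertialPairing (v : MeasureTheory.Lp (EuclideanSpace ℝ (Fin 3)) 2 (MeasureTheory.volume : MeasureTheory.Measure (UnitAddTorus (Fin 3))))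 (Φ.grad v)) = 0) → (⨅ p : {p : ℤ × ℤ // p ≠ 0}, (1 / 2 : ℝ) * ∫ s in (0 : ℝ)..1, ∫ x, ‖((v : MeasureTheory.Lp (EuclideanSpace ℝ (Fin 3)) 2 (MeasureTheory.volume : MeasureTheory.Measure (UnitAddTorus (Fin 3)))) : UnitAddTorus (Fin 3) → EuclideanSpace ℝ (Fin 3)) (x + Literature.Analysis.FluidPDE.toTorus (fun i => s * (![((p.1.1 : ℤ) : ℝ), 0, ((p.1.2 : ℤ) : ℝ)] : Fin 3 → ℝ) i)) - ((v : MeasureTheory.Lp (EuclideanSpace ℝ (Fin 3)) 2 (MeasureTheory.volume : MeasureTheory.Measure (UnitAddTorus (Fin 3)))) : UnitAddTorus (Fin 3) → EuclideanSpace ℝ (Fin 3)) x‖ ^ 2) = 0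

/-- item stmt-AnomalousDissipation-27872 · support · rank 9 · open · by planner
why it might fail: Essentially cannot fail mathematically (Krein–Milman + portmanteau); the Lean risk is the weak-* topology plumbing on Measure H and matching Set.extremePoints ENNReal with real convexity of probability measures.
sources: corpus:book:foias2001-navier-stokes-equations-turbulence p.244 (Thm A.9 Krein–Milman), p.336 (M₀(R₀) weak-star compact), Mathlib/Analysis/Convex/KreinMilman.lean:96 closure_convexHull_extremePoints, Mathlib/MeasureTheory/Measure/Portmanteau.lean:326
[support · rank 9 · THEOREM-GRADE · lens-4 g17 node SpectralHullCut] EXTREME CLIMATE REDUCTION: for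
every drift m and level R, if every extreme point of the convex set C(m,R) of tame Euler climates of
f_K with drift m is planar a.s., then every member of C(m,R) is planar a.s. (conclusion spelled
exactly as TEP 27427's body). Proof route: C(m,R) is weak-* compact convex (Prokhorov on the
Rellich-compact enstrophy ball; tameness and stationarity closed, stationarity linear — FMRT's
M₀(R₀)); {μ : μ{inf_p A_p > 0} = 0} is convex and weak-* closed (inf_p A_p is L²-continuous ⇒ open
set; portmanteau ProbabilityMeasure.le_liminf_measure_open_of_tendsto); Krein–Milman
closure_convexHull_extremePoints after an affine embedding into a locally convex space. Kernel
weakerER (TEP → this). Kernel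
run/shared/lean/pub/decomp-ad/decomp-ad-lens-4/g17/SpectralHullCut.lean -/
@[route_item "route-AnomalousDissipation-CoherentFraction"]
def ExtremeClimateReduction : Prop :=
  ∀ (m : EuclideanSpace ℝ (Fin 3)) (R : ℝ), (∀ μ : MeasureTheory.Measure (Literature.Analysis.FunctionSpaces.Torus.energySpace (Fin 3)), μ ∈ Set.extremePoints ENNReal {ρ : MeasureTheory.Measure (Literature.Analysis.FunctionSpaces.Torus.energySpace (Fin 3)) | MeasureTheory.IsProbabilityMeasure ρ ∧ (∀ᵐ (v : ↥(Literature.Analysis.FunctionSpaces.Torus.energySpace (Fin 3))) ∂ρ, Literature.Analysis.FunctionSpaces.Torus.eGradNormSq ((v : MeasureTheory.Lp (EuclideanSpace ℝ (Fin 3)) 2 (MeasureTheory.volume : MeasureTheory.Measure (UnitAddTorus (Fin 3)))) : UnitAddTorus (Fin 3) → EuclideanSpace ℝ (Fin 3)) ≤ ENNReal.ofReal R) ∧ (∀ Φ : Literature.Analysis.FluidPDE.Torus.CylindricalTest (Fin 3), ∫ v, ((∫ x, ⟪⇑(Literature.Analysis.FluidPDE.Torus.stokesMode (![0, 2, 0]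 : Fin 3 → ℤ) (EuclideanSpace.single (0 : Fin 3) (1 : ℝ)) false) x, Φ.grad v x⟫_ℝ) + (∫ x, ⟪((v : MeasureTheory.Lp (EuclideanSpace ℝ (Fin 3)) 2 (MeasureTheory.volume : MeasureTheory.Measure (UnitAddTorus (Fin 3)))) : UnitAddTorus (Fin 3) → EuclideanSpace ℝ (Fin 3)) x, Literature.Analysis.FunctionSpaces.Torus.fderiv (Φ.grad v) x m⟫_ℝ) + Literature.Analysis.FluidPDE.Torus.inertialPairing (v : MeasureTheory.Lp (EuclideanSpace ℝ (Fin 3)) 2 (MeasureTheory.volume : MeasureTheory.Measure (UnitAddTorus (Fin 3)))) (Φ.grad v)) ∂ρ = 0)} → ∀ᵐ (v : ↥(Literature.Analysis.FunctionSpaces.Torus.energySpace (Fin 3))) ∂μ, (⨅ p : {p : ℤ × ℤ // p ≠ 0}, (1 / 2 : ℝ) * ∫ s in (0 : ℝ)..1, ∫ x, ‖((v : MeasureTheory.Lp (EuclideanSpace ℝ (Fin 3)) 2 (MeasureTheory.volume : MeasureTheory.Measure (UnitAddTorus (Fin 3)))) : UnitAddTorus (Fin 3) → EuclideanSpace ℝ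 (Fin 3)) (x + Literature.Analysis.FluidPDE.toTorus (fun i => s * (![((p.1.1 : ℤ) : ℝ), 0, ((p.1.2 : ℤ) : ℝ)] : Fin 3 → ℝ) i)) - ((v : MeasureTheory.Lp (EuclideanSpace ℝ (Fin 3)) 2 (MeasureTheory.volume : MeasureTheory.Measure (UnitAddTorus (Fin 3)))) : UnitAddTorus (Fin 3) → EuclideanSpace ℝ (Fin 3)) x‖ ^ 2) = 0) → ∀ μ : MeasureTheory.Measure (Literature.Analysis.FunctionSpaces.Torus.energySpace (Fin 3)), MeasureTheory.IsProbabilityMeasure μ → (∀ᵐ (v : ↥(Literature.Analysis.FunctionSpaces.Torus.energySpace (Fin 3))) ∂μ, Literature.Analysis.FunctionSpaces.Torus.eGradNormSq ((v : MeasureTheory.Lp (EuclideanSpace ℝ (Fin 3)) 2 (MeasureTheory.volume : MeasureTheory.Measure (UnitAddTorus (Fin 3)))) : UnitAddTorus (Fin 3) → EuclideanSpace ℝ (Fin 3)) ≤ ENNReal.ofReal R) → (∀ Φ : Literature.Analysis.FluidPDE.Torus.CylindricalTest (Fin 3), ∫ v, ((∫ x, ⟪⇑(Literature.Analysis.FluidPDE.Torus.stokesMode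 (![0, 2, 0] : Fin 3 → ℤ) (EuclideanSpace.single (0 : Fin 3) (1 : ℝ)) false) x, Φ.grad v x⟫_ℝ) + (∫ x, ⟪((v : MeasureTheory.Lp (EuclideanSpace ℝ (Fin 3)) 2 (MeasureTheory.volume : MeasureTheory.Measure (UnitAddTorus (Fin 3)))) : UnitAddTorus (Fin 3) → EuclideanSpace ℝ (Fin 3)) x, Literature.Analysis.FunctionSpaces.Torus.fderiv (Φ.grad v) x m⟫_ℝ) + Literature.Analysis.FluidPDE.Torus.inertialPairing (v : MeasureTheory.Lp (EuclideanSpace ℝ (Fin 3)) 2 (MeasureTheory.volume : MeasureTheory.Measure (UnitAddTorus (Fin 3)))) (Φ.grad v)) ∂μ = 0) → ∀ᵐ (v : ↥(Literature.Analysis.FunctionSpaces.Torus.energySpace (Fin 3))) ∂μ, (⨅ p : {p : ℤ × ℤ // p ≠ 0}, (1 / 2 : ℝ) * ∫ s in (0 : ℝ)..1, ∫ x, ‖((v : MeasureTheory.Lp (EuclideanSpace ℝ (Fin 3)) 2 (MeasureTheory.volume : MeasureTheory.Measure (UnitAddTorus (Fin 3)))) : UnitAddTorus (Fin 3) → EuclideanSpace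 ℝ (Fin 3)) (x + Literature.Analysis.FluidPDE.toTorus (fun i => s * (![((p.1.1 : ℤ) : ℝ), 0, ((p.1.2 : ℤ) : ℝ)] : Fin 3 → ℝ) i)) - ((v : MeasureTheory.Lp (EuclideanSpace ℝ (Fin 3)) 2 (MeasureTheory.volume : MeasureTheory.Measure (UnitAddTorus (Fin 3)))) : UnitAddTorus (Fin 3) → EuclideanSpace ℝ (Fin 3)) x‖ ^ 2) = 0

/-- item stmt-AnomalousDissipation-27873 · support · rank 9 · closed · proved by Summit.AnomalousDissipation.AnomalousDissipation.Theorems.SpectralHullGlue.spectralHullGlue_holds (prover) · by planner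
why it might fail: Proved (kernel spectralHull_split, axioms propext/Classical.choice/Quot.sound); only a paste can fail.
sources: run/shared/lean/pub/decomp-ad/decomp-ad-lens-4/g17/SpectralHullCut.lean
[support · rank 9 · GLUE of the SpectralHullCut · PROVED in the kernel (spectralHullGlue_holds:
ExtremeClimateReduction, then excluded middle on «the extreme climate is δ_v with v finite-mode»,
MeasureTheory.ae_dirac_eq, MeasureTheory.integral_dirac on the Borel space H); landable by pasting]
FiniteModeRootsPlanar → ExtremeClimatesPlanarBeyondFiniteModes → ExtremeClimateReduction →
TameEulerClimatesPlanar. Kernel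
run/shared/lean/pub/decomp-ad/decomp-ad-lens-4/g17/SpectralHullCut.lean -/
@[route_item "route-AnomalousDissipation-CoherentFraction"]
def SpectralHullGlue : Prop :=
  FiniteModeRootsPlanar → ExtremeClimatesPlanarBeyondFiniteModes → ExtremeClimateReduction → TameEulerClimatesPlanar

-- `SpectralHullGlue` holds: proved by `Summit.AnomalousDissipation.AnomalousDissipation.Theorems.SpectralHullGlue.spectralHullGlue_holds` (its module imports this route file, so no `_holds` link can be stated here).

/-- item stmt-AnomalousDissipation-28073 · support · rank 9 · open · by planner
why it might fail: A non-planar finite-mode root or time-dependent finite-mode solution exploiting the forced-pair exemption on a hull EDGE through (0,±1,0) (supports with a face whose diagonals are the two forced pairs are excluded by holonomy, card §13); decidable by finite algebra (T-QROOT-ALG).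
sources: arXiv:2110.08039 Thm 1.4, Lemma 2.1, Prop 2.2, Prop 4.4 (Kishimoto–Yoneda, JMFM 24 (2022) 74), Elgindi–Hu–Šverák, Comm. Math. Phys. 355 (2017) 145–159, Literature/Barriers/AnomalousDissipation/QuietRootFloorBarrier.lean
[support · rank 9 · THEOREM-GRADE TARGET · ATTACKABLE NOW · lens-4 g18 node QuotientHullCut]
FINITE-TYPE CLIMATES ARE PLANAR: for every drift m and enstrophy level R, every tame Euler climate
of f_K = sin(4πx₁)e₀ with drift m (Borel probability measure on H, ‖∇v‖² ≤ R a.s., stationary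
against every cylindrical test) of FINITE FOURIER TYPE (for one N, a.e. field equals its truncation
fourierTruncate N) is planar a.s. Route: finite type + stationarity ⇒ no spill a.e.;
finite-dimensional Liouville ⇒ invariance under the Galerkin flow ⇒ support on global finite-mode
solutions of Euler + drift + f_K; forced Kishimoto–Yoneda rigidity (arXiv:2110.08039, natively
time-dependent) at the forced pair ±(0,2,0). Implies the rung FiniteModeRootsPlanar 27870 (kernel
finiteType_implies_finiteModeRoots). Kernel
run/shared/lean/pub/decomp-ad/decomp-ad-lens-4/g18/QuotientHullCut.lean -/
@[route_item "route-AnomalousDissipation-CoherentFraction"]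
def FiniteTypeClimatesPlanar : Prop :=
  ∀ (m : EuclideanSpace ℝ (Fin 3)) (R : ℝ) (μ : MeasureTheory.Measure (Literature.Analysis.FunctionSpaces.Torus.energySpace (Fin 3))), MeasureTheory.IsProbabilityMeasure μ → (∀ᵐ (v : ↥(Literature.Analysis.FunctionSpaces.Torus.energySpace (Fin 3))) ∂μ, Literature.Analysis.FunctionSpaces.Torus.eGradNormSq ((v : MeasureTheory.Lp (EuclideanSpace ℝ (Fin 3)) 2 (MeasureTheory.volume : MeasureTheory.Measure (UnitAddTorus (Fin 3)))) : UnitAddTorus (Fin 3) → EuclideanSpace ℝ (Fin 3)) ≤ ENNReal.ofReal R) → (∀ Φ : Literature.Analysis.FluidPDE.Torus.CylindricalTest (Fin 3), ∫ v, ((∫ x, ⟪⇑(Literature.Analysis.FluidPDE.Torus.stokesMode (![0, 2, 0] : Fin 3 → ℤ) (EuclideanSpace.single (0 : Fin 3) (1 : ℝ)) false) x, Φ.grad v x⟫_ℝ) + (∫ x, ⟪((v : MeasureTheory.Lp (EuclideanSpace ℝ (Fin 3)) 2 (MeasureTheory.volume : MeasureTheory.Measure (UnitAddTorus (Fin 3))))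 : UnitAddTorus (Fin 3) → EuclideanSpace ℝ (Fin 3)) x, Literature.Analysis.FunctionSpaces.Torus.fderiv (Φ.grad v) x m⟫_ℝ) + Literature.Analysis.FluidPDE.Torus.inertialPairing (v : MeasureTheory.Lp (EuclideanSpace ℝ (Fin 3)) 2 (MeasureTheory.volume : MeasureTheory.Measure (UnitAddTorus (Fin 3)))) (Φ.grad v)) ∂μ = 0) → (∃ N : ℕ, ∀ᵐ (v : ↥(Literature.Analysis.FunctionSpaces.Torus.energySpace (Fin 3))) ∂μ, ((v : MeasureTheory.Lp (EuclideanSpace ℝ (Fin 3)) 2 (MeasureTheory.volume : MeasureTheory.Measure (UnitAddTorus (Fin 3)))) : UnitAddTorus (Fin 3) → EuclideanSpace ℝ (Fin 3)) =ᵐ[MeasureTheory.volume] Literature.Analysis.FunctionSpaces.Torus.fourierTruncate N ((v : MeasureTheory.Lp (EuclideanSpace ℝ (Fin 3)) 2 (MeasureTheory.volume : MeasureTheory.Measure (UnitAddTorus (Fin 3)))) : UnitAddTorus (Fin 3) → EuclideanSpace ℝ (Fin 3))) → ∀ᵐ (v : ↥(Literature.Analysis.FunctionSpaces.Torus.energySpace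 (Fin 3))) ∂μ, (⨅ p : {p : ℤ × ℤ // p ≠ 0}, (1 / 2 : ℝ) * ∫ s in (0 : ℝ)..1, ∫ x, ‖((v : MeasureTheory.Lp (EuclideanSpace ℝ (Fin 3)) 2 (MeasureTheory.volume : MeasureTheory.Measure (UnitAddTorus (Fin 3)))) : UnitAddTorus (Fin 3) → EuclideanSpace ℝ (Fin 3)) (x + Literature.Analysis.FluidPDE.toTorus (fun i => s * (![((p.1.1 : ℤ) : ℝ), 0, ((p.1.2 : ℤ) : ℝ)] : Fin 3 → ℝ) i)) - ((v : MeasureTheory.Lp (EuclideanSpace ℝ (Fin 3)) 2 (MeasureTheory.volume : MeasureTheory.Measure (UnitAddTorus (Fin 3)))) : UnitAddTorus (Fin 3) → EuclideanSpace ℝ (Fin 3)) x‖ ^ 2) = 0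

/-- item stmt-AnomalousDissipation-28075 · support · rank 9 · open · by planner
why it might fail: Essentially cannot fail mathematically (Krein–Milman + averaging over a compact symmetry group); Lean risk = weak-* plumbing on Measure H and the translation action on energySpace.
sources: corpus:book:foias2001-navier-stokes-equations-turbulence p.244 (Thm A.9 Krein–Milman), p.336, Mathlib/Analysis/Convex/KreinMilman.lean closure_convexHull_extremePoints, Literature/Analysis/FunctionSpaces/TorusAxisAverage.lean
[support · rank 9 · THEOREM-GRADE · lens-4 g18 node QuotientHullCut] INVARIANT EXTREME REDUCTION:
for every drift m and level R, if every extreme point of C̄(m,R) (tame climates stationary for every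
drift m+h, h horizontal) is planar a.s., then every tame Euler climate of f_K with drift m is planar
a.s. (conclusion = TEP 27427 body verbatim). Proof route: Krein–Milman on the weak-* compact convex
C̄(m,R) (Prokhorov on the Rellich-compact enstrophy ball; all conditions closed and affine;
portmanteau for the open non-planar set) gives planarity on C̄(m,R); the horizontal-translation
average μ̄ of μ ∈ C(m,R) lies in C̄(m,R) (translation covariance of cylindrical tests; the extra
drift term is ∫ d/ds Φ(τ_s v) ds = 0) and μ̄{non-planar} = μ{non-planar}. Tree infrastructure
Torus.axisAvg / mFourierCoeff_comp_add_single. Kernel weakerQR (TEP → this). Kernel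
run/shared/lean/pub/decomp-ad/decomp-ad-lens-4/g18/QuotientHullCut.lean -/
@[route_item "route-AnomalousDissipation-CoherentFraction"]
def InvariantExtremeReduction : Prop :=
  ∀ (m : EuclideanSpace ℝ (Fin 3)) (R : ℝ), (∀ μ : MeasureTheory.Measure (Literature.Analysis.FunctionSpaces.Torus.energySpace (Fin 3)), μ ∈ Set.extremePoints ENNReal {ρ : MeasureTheory.Measure (Literature.Analysis.FunctionSpaces.Torus.energySpace (Fin 3)) | MeasureTheory.IsProbabilityMeasure ρ ∧ (∀ᵐ (v : ↥(Literature.Analysis.FunctionSpaces.Torus.energySpace (Fin 3))) ∂ρ, Literature.Analysis.FunctionSpaces.Torus.eGradNormSq ((v : MeasureTheory.Lp (EuclideanSpace ℝ (Fin 3)) 2 (MeasureTheory.volume : MeasureTheory.Measure (UnitAddTorus (Fin 3)))) : UnitAddTorus (Fin 3) → EuclideanSpace ℝ (Fin 3)) ≤ ENNReal.ofReal R) ∧ (∀ h : EuclideanSpace ℝ (Fin 3), ⟪h, EuclideanSpace.single (1 : Fin 3) (1 : ℝ)⟫_ℝ = 0 → (∀ Φ : Literature.Analysis.FluidPDE.Torus.CylindricalTest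 (Fin 3), ∫ v, ((∫ x, ⟪⇑(Literature.Analysis.FluidPDE.Torus.stokesMode (![0, 2, 0] : Fin 3 → ℤ) (EuclideanSpace.single (0 : Fin 3) (1 : ℝ)) false) x, Φ.grad v x⟫_ℝ) + (∫ x, ⟪((v : MeasureTheory.Lp (EuclideanSpace ℝ (Fin 3)) 2 (MeasureTheory.volume : MeasureTheory.Measure (UnitAddTorus (Fin 3)))) : UnitAddTorus (Fin 3) → EuclideanSpace ℝ (Fin 3)) x, Literature.Analysis.FunctionSpaces.Torus.fderiv (Φ.grad v) x (m + h)⟫_ℝ) + Literature.Analysis.FluidPDE.Torus.inertialPairing (v : MeasureTheory.Lp (EuclideanSpace ℝ (Fin 3)) 2 (MeasureTheory.volume : MeasureTheory.Measure (UnitAddTorus (Fin 3)))) (Φ.grad v)) ∂ρ = 0))} → ∀ᵐ (v : ↥(Literature.Analysis.FunctionSpaces.Torus.energySpace (Fin 3))) ∂μ, (⨅ p : {p : ℤ × ℤ // p ≠ 0}, (1 / 2 : ℝ) * ∫ s in (0 : ℝ)..1, ∫ x, ‖((v : MeasureTheory.Lp (EuclideanSpace ℝ (Fin 3)) 2 (MeasureTheory.volume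 : MeasureTheory.Measure (UnitAddTorus (Fin 3)))) : UnitAddTorus (Fin 3) → EuclideanSpace ℝ (Fin 3)) (x + Literature.Analysis.FluidPDE.toTorus (fun i => s * (![((p.1.1 : ℤ) : ℝ), 0, ((p.1.2 : ℤ) : ℝ)] : Fin 3 → ℝ) i)) - ((v : MeasureTheory.Lp (EuclideanSpace ℝ (Fin 3)) 2 (MeasureTheory.volume : MeasureTheory.Measure (UnitAddTorus (Fin 3)))) : UnitAddTorus (Fin 3) → EuclideanSpace ℝ (Fin 3)) x‖ ^ 2) = 0) → ∀ μ : MeasureTheory.Measure (Literature.Analysis.FunctionSpaces.Torus.energySpace (Fin 3)), MeasureTheory.IsProbabilityMeasure μ → (∀ᵐ (v : ↥(Literature.Analysis.FunctionSpaces.Torus.energySpace (Fin 3))) ∂μ, Literature.Analysis.FunctionSpaces.Torus.eGradNormSq ((v : MeasureTheory.Lp (EuclideanSpace ℝ (Fin 3)) 2 (MeasureTheory.volume : MeasureTheory.Measure (UnitAddTorus (Fin 3)))) : UnitAddTorus (Fin 3) → EuclideanSpace ℝ (Fin 3)) ≤ ENNReal.ofReal R) → (∀ Φ : Literature.Analysis.FluidPDE.Torus.CylindricalTest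 (Fin 3), ∫ v, ((∫ x, ⟪⇑(Literature.Analysis.FluidPDE.Torus.stokesMode (![0, 2, 0] : Fin 3 → ℤ) (EuclideanSpace.single (0 : Fin 3) (1 : ℝ)) false) x, Φ.grad v x⟫_ℝ) + (∫ x, ⟪((v : MeasureTheory.Lp (EuclideanSpace ℝ (Fin 3)) 2 (MeasureTheory.volume : MeasureTheory.Measure (UnitAddTorus (Fin 3)))) : UnitAddTorus (Fin 3) → EuclideanSpace ℝ (Fin 3)) x, Literature.Analysis.FunctionSpaces.Torus.fderiv (Φ.grad v) x m⟫_ℝ) + Literature.Analysis.FluidPDE.Torus.inertialPairing (v : MeasureTheory.Lp (EuclideanSpace ℝ (Fin 3)) 2 (MeasureTheory.volume : MeasureTheory.Measure (UnitAddTorus (Fin 3)))) (Φ.grad v)) ∂μ = 0) → ∀ᵐ (v : ↥(Literature.Analysis.FunctionSpaces.Torus.energySpace (Fin 3))) ∂μ, (⨅ p : {p : ℤ × ℤ // p ≠ 0}, (1 / 2 : ℝ) * ∫ s in (0 : ℝ)..1, ∫ x, ‖((v : MeasureTheory.Lp (EuclideanSpace ℝ (Fin 3)) 2 (MeasureTheory.volume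 : MeasureTheory.Measure (UnitAddTorus (Fin 3)))) : UnitAddTorus (Fin 3) → EuclideanSpace ℝ (Fin 3)) (x + Literature.Analysis.FluidPDE.toTorus (fun i => s * (![((p.1.1 : ℤ) : ℝ), 0, ((p.1.2 : ℤ) : ℝ)] : Fin 3 → ℝ) i)) - ((v : MeasureTheory.Lp (EuclideanSpace ℝ (Fin 3)) 2 (MeasureTheory.volume : MeasureTheory.Measure (UnitAddTorus (Fin 3)))) : UnitAddTorus (Fin 3) → EuclideanSpace ℝ (Fin 3)) x‖ ^ 2) = 0

/-- item stmt-AnomalousDissipation-28076 · support · rank 9 · open · by planner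
why it might fail: Cannot fail mathematically (translation covariance of cylindrical tests, chain rule along the C¹ curve s ↦ v₀(·−s e₀) in H, trigonometric density argument); Lean size M–L (pushforward of Lebesgue under the orbit map, differentiation under the cylindrical test).
sources: corpus:book:holmes2012-turbulence-coherent-structures-dynamical-systems-symmetry p.245 (O(2)-equivariance, travelling waves as relative equilibria), corpus:book:foias2001-navier-stokes-equations-turbulence p.362 (Vishik–Fursikov homogeneous statistical solutions), run/shared/lean/pub/decomp-ad/decomp-ad-lens-4/g18/QuotientHullCut_NODE.md §1
[support · rank 9 · THEOREM-GRADE · ERRATUM CERTIFICATE · lens-4 g18] TRAVELLING-WAVE TRANSFER: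
ExtremeClimatesPlanarBeyondFiniteModes (27871) → FiniteModeRootsPlanar (27870). A non-planar
finite-mode root v₀ of drift m′ yields the circle climate ∫₀¹ δ_{v₀(·−s e₀)} ds, which is tame,
stationary for EVERY drift m′+λe₀ (the extra drift term integrates to λ∫ d/ds Φ = 0), EXTREME in
C(m′+λe₀,R) for λ ≠ 0 (a density r(s) with ∫ r·(Φ∘V)′ ds = 0 for all cylindrical Φ is constant), not
a Dirac mass and non-planar a.s. Consequence (kernel erratum_residual_equiv): 27871 ∧ 27872 ⟺ 27427,
i.e. the g17 residual is TEP-strength; proposed retriage 27871 → aside. Kernel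
run/shared/lean/pub/decomp-ad/decomp-ad-lens-4/g18/QuotientHullCut.lean -/
@[route_item "route-AnomalousDissipation-CoherentFraction"]
def TravellingWaveTransfer : Prop :=
  ExtremeClimatesPlanarBeyondFiniteModes → FiniteModeRootsPlanar

/-- item stmt-AnomalousDissipation-28077 · support · rank 9 · closed · proved by Summit.AnomalousDissipation.AnomalousDissipation.Theorems.QuotientHullGlue.quotientHullGlue_holds (prover) · by planner
why it might fail: Proved (kernel quotientHull_split); only a paste can fail.
sources: run/shared/lean/pub/decomp-ad/decomp-ad-lens-4/g18/QuotientHullCut.lean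
[support · rank 9 · GLUE of the QuotientHullCut · PROVED in the kernel (quotientHull_split:
InvariantExtremeReduction, then excluded middle on the Fourier type of the extreme climate;
member-of-C(m,R) step h = 0 by inner_zero_left/add_zero); landable by pasting]
FiniteTypeClimatesPlanar → InvariantExtremeClimatesPlanar → InvariantExtremeReduction →
TameEulerClimatesPlanar. Kernel
run/shared/lean/pub/decomp-ad/decomp-ad-lens-4/g18/QuotientHullCut.lean -/
@[route_item "route-AnomalousDissipation-CoherentFraction"]
def QuotientHullGlue : Prop :=
  FiniteTypeClimatesPlanar → InvariantExtremeClimatesPlanar → InvariantExtremeReduction → TameEulerClimatesPlanar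

-- `QuotientHullGlue` holds: proved by `Summit.AnomalousDissipation.AnomalousDissipation.Theorems.QuotientHullGlue.quotientHullGlue_holds` (its module imports this route file, so no `_holds` link can be stated here).

/-- item stmt-AnomalousDissipation-33800 · aside · rank 9 · open · by planner
sources: doi:10.1088/0169-5983/48/6/061425, doi:10.1017/jfm.2017.97
[aside · rank 9 · TYPED MECHANISM STATEMENT = the conclusion of CoherentFractionPersists (inlined
there) · never staffed · kernel (cell node file HOME/decomp-ad-lens-4/g14/CoherentFraction.lean):
BoundedThreeDCoherentStates → SymmetricOrLoud.RelativelyThreeDTrajectories → ThreeDFractionOrLoud →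
EjectionPersists, and → ClassTrim.RecurrentEjectionPersists (OR-sibling booking)] bounded exact
coherent (time-periodic, global Leray–Hopf) states of NS_ν_j(sin(4πx₁)e₀), ν_j → 0, with meanEnergy
≤ E₀, positive mean planar-symmetry defect and defect ≥ φ₀ · meanEnergy, φ₀ > 0 uniform in j. -/
@[route_item "route-AnomalousDissipation-CoherentFraction"]
def BoundedThreeDCoherentStates : Prop :=
  ∃ (E₀ φ₀ : ℝ), 0 < E₀ ∧ 0 < φ₀ ∧ ∃ (ν : ℕ → ℝ), (∀ j, 0 < ν j) ∧ (∀ j, ν j ≤ 1) ∧ Filter.Tendsto ν Filter.atTop (nhds 0) ∧ ∀ j, ∃ (T : ℝ) (u₀ : UnitAddTorus (Fin 3) → EuclideanSpace ℝ (Fin 3)) (u : ℝ → UnitAddTorus (Fin 3) → EuclideanSpace ℝ (Fin 3)), 0 < T ∧ Literature.Analysis.FluidPDE.Torus.IsGlobalLerayHopf (ν j) (fun _ => ⇑(Literature.Analysis.FluidPDE.Torus.stokesMode (![0, 2, 0] : Fin 3 → ℤ) (EuclideanSpace.single (0 : Fin 3) (1 : ℝ)) false)) u₀ u ∧ Function.Periodic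 u T ∧ Literature.Analysis.FluidPDE.meanEnergy u ≤ E₀ ∧ 0 < Literature.Analysis.FluidPDE.longTimeAvgSup (fun t => ⨅ p : {p : ℤ × ℤ // p ≠ 0}, (1 / 2 : ℝ) * ∫ s in (0 : ℝ)..1, ∫ x, ‖u t (x + Literature.Analysis.FluidPDE.toTorus (fun i => s * (![((p.1.1 : ℤ) : ℝ), 0, ((p.1.2 : ℤ) : ℝ)] : Fin 3 → ℝ) i)) - u t x‖ ^ 2) ∧ φ₀ * Literature.Analysis.FluidPDE.meanEnergy u ≤ Literature.Analysis.FluidPDE.longTimeAvgSup (fun t => ⨅ p : {p : ℤ × ℤ // p ≠ 0}, (1 / 2 : ℝ) * ∫ s in (0 : ℝ)..1, ∫ x, ‖u t (x + Literature.Analysis.FluidPDE.toTorus (fun i => s * (![((p.1.1 : ℤ) : ℝ), 0, ((p.1.2 : ℤ) : ℝ)] : Fin 3 → ℝ) i)) - u t x‖ ^ 2)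

/-- item stmt-AnomalousDissipation-33799 · assembly · rank 1 · open · by planner
sources: DoeringFoias2002, doi:10.1016/0021-8928(61)90079-2
[assembly] RatioUpgrade → BoundedQuietPlanarity → BoundedNonPlanarCoherentStates →
CoherentFractionPersists → the zeroth law (literally theorem closes). -/
@[route_item "route-AnomalousDissipation-CoherentFraction"]
def Assembly : Prop :=
  RatioUpgrade → BoundedQuietPlanarity → BoundedNonPlanarCoherentStates → CoherentFractionPersists → _root_.AnomalousDissipation

-- records of items no longer active in this route (dropped / restated):
-- earlier ExtremeClimatesPlanarBeyondFiniteModes (stmt-AnomalousDissipation-27871, dropped 2026-09-03T21:52:45Z): refuted by Summit.AnomalousDissipation.AnomalousDissipation.Theorems.CrossedShearRoot.not_extremeClimatesPlanarBeyondFiniteModes — ∀ (m : EuclideanSpace ℝ (Fin 3)) (R : ℝ) (μ : MeasureTheory.Measure (Literature.Analysis.FunctionSpaces.Torus.energySpace (Fin 3))), μ ∈ Set.extremePoints EN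
-- earlier InvariantExtremeClimatesPlanar (stmt-AnomalousDissipation-28074, dropped 2026-09-04T05:45:44Z): refuted by Summit.AnomalousDissipation.AnomalousDissipation.Theorems.CrossedShearOrbit.CoherentFractionInvariantExtremeClimatesPlanar_refuted — ∀ (m : EuclideanSpace ℝ (Fin 3)) (R : ℝ) (μ : MeasureTheory.Measure (Literature.Analysis.FunctionSpaces.Torus.energySpace (Fin 3))), μ ∈ Set.extremePoin

/-! D-0027 §2.1 — DECIDING THEOREM (planner-authored via `route open/edit --closes-file`; by planner-decomp-ad-lens-4-g14-0 2026-08-30T14:45:24Z):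
its hypotheses are this route's items and its conclusion the sub-problem Statement (glue_lint), and it elaborates with this file. -/

@[closes "route-AnomalousDissipation-CoherentFraction"] theorem closes (h₁ : RatioUpgrade) (hB : BoundedQuietPlanarity)
    (hC : BoundedNonPlanarCoherentStates) (hU : CoherentFractionPersists) : _root_.AnomalousDissipation := by
  obtain ⟨E₀, φ₀, hE₀, hφ₀, ν, hν, hν1, hν0, hfam⟩ := hU hC
  obtain ⟨θ₀, hθ₀, hrig⟩ := hB (φ₀ / 2) (by positivity) E₀ hE₀
  apply h₁
  have hk : ((![0, 2, 0] : Fin 3 → ℤ)) ≠ 0 := by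
    intro h
    have := congrFun h 1
    simp at this
  have hka : inner ℝ (Literature.Analysis.FunctionSpaces.Torus.latticeVec ((![0, 2, 0] : Fin 3 → ℤ)))
      (EuclideanSpace.single (0 : Fin 3) (1 : ℝ)) = 0 := by
    rw [EuclideanSpace.inner_single_right]
    simp [Literature.Analysis.FunctionSpaces.Torus.latticeVec_apply]
  have key : ∀ j, ∃ (u₀ : UnitAddTorus (Fin 3) → EuclideanSpace ℝ (Fin 3))
      (u : ℝ → UnitAddTorus (Fin 3) → EuclideanSpace ℝ (Fin 3)),
      Literature.Analysis.FluidPDE.Torus.IsGlobalLerayHopf (ν j)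
          (fun _ => ⇑(Literature.Analysis.FluidPDE.Torus.stokesMode ((![0, 2, 0] : Fin 3 → ℤ))
            (EuclideanSpace.single (0 : Fin 3) (1 : ℝ)) false)) u₀ u ∧
        θ₀ * Literature.Analysis.FluidPDE.meanEnergy u <
          Literature.Analysis.FluidPDE.meanDissipation (ν j) u := by
    intro j
    obtain ⟨T, u₀, u, -, hLH, -, hE, hpos, hfrac⟩ := hfam j
    refine ⟨u₀, u, hLH, ?_⟩
    by_contra hq
    rw [not_lt] at hq
    have hsmall := hrig (ν j) (hν j) (hν1 j) u₀ u hLH hE hq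
    have hEle : Literature.Analysis.FluidPDE.meanEnergy u ≤ 0 := by
      by_contra hc
      push Not at hc
      have := mul_pos (half_pos hφ₀) hc
      linarith
    have hdef : Literature.Analysis.FluidPDE.longTimeAvgSup (fun t => ⨅ p : {p : ℤ × ℤ // p ≠ 0}, (1 / 2 : ℝ) *
        ∫ s in (0 : ℝ)..1, ∫ x, ‖u t (x + Literature.Analysis.FluidPDE.toTorus (fun i => s *
          (![((p.1.1 : ℤ) : ℝ), 0, ((p.1.2 : ℤ) : ℝ)] : Fin 3 → ℝ) i)) - u t x‖ ^ 2) ≤ 0 :=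
      hsmall.trans (mul_nonpos_iff.mpr (Or.inl ⟨(half_pos hφ₀).le, hEle⟩))
    exact absurd hpos (not_lt.mpr hdef)
  choose u₀ u hu using key
  exact ⟨⇑(Literature.Analysis.FluidPDE.Torus.stokesMode ((![0, 2, 0] : Fin 3 → ℤ))
      (EuclideanSpace.single (0 : Fin 3) (1 : ℝ)) false),
    Literature.Analysis.FluidPDE.Torus.isSmooth_stokesMode _ _ _,
    Literature.Analysis.FluidPDE.Torus.isDivFree_stokesMode hka false,
    Literature.Analysis.FluidPDE.Torus.hasZeroMean_stokesMode hk _ _,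
    θ₀, hθ₀, ν, u₀, u, hν, hν0, fun j => (hu j).1, fun j => (hu j).2⟩

end Summit.AnomalousDissipation.AnomalousDissipation.Theses.CoherentFraction
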